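import Literature.Probability.RandomPlanarGeometry.SAWStripInsertionMargin
import Mathlib.Analysis.SpecialFunctions.Pow.Real
import Mathlib.Analysis.SpecialFunctions.Pow.Continuity
import Mathlib.Analysis.SpecificLimits.Normed
import HarnessLib

/-!
# Strict inequalities for self-avoiding walks in tubes and slabs `R[k,T] ⊂ ℤ^d` with explicit margins
# (Madras–Slade Theorem 8.2.1, (8.2.11) and (8.2.13), every `1 ≤ k ≤ d-1`) by the top-edge lift

For `R[k,T] = ℤ^k × {0,…,T}^{d-k}` (`Zd.InTube d k T`; `μ(R[k,T]) = Zd.tubeConnectiveConstant d k T`) and every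
`d ≥ 2`, `1 ≤ k ≤ d-1`, `T ≥ 0` (dimension written `d + 2` below), with `Q := 4(T+1)²(2T+1)^{d-1}`:

* `TopLift.log_tubeConnectiveConstant_succ_sub_log_ge` — `log(1 + μ(R[k,T+1])^{-(2T+2)}) / Q ≤ log μ(R[k,T+1]) − log μ(R[k,T])`;
* `TopLift.log_connectiveConstant_sub_log_tubeConnectiveConstant_ge` — `log(1 + μ(ℤ^d)^{-(2T+2)}) / Q ≤ log μ(ℤ^d) − log μ(R[k,T])`;
* `TopLift.tubeConnectiveConstant_lt_succ`, `…_lt_connectiveConstant`, `strictMono_…` — the printed strict inequalities.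

Everything except the seven cited public statements is `private` machinery (lane pcv-sawmu item X21; text of
record a-idea-2 ROUTES v4.1 §15 — here the single-level variant with density `1/Q`; refute-first guards PREREG
Am. I signed by a-ref-1, a-ref-2, bench).  Tree twins: `SAWStripInsertionMargin.lean` (`k = 1`, `d = 2`) and
`SAWTubeInsertionMargin.lean` (`k = 1`, every `d`) by column insertion with better constants for `k = 1`; the
qualitative Theorem 8.2.1 by the printed renewal argument is the `SAWTubeRenewal.lean` line.  Note on numbering:
(8.2.11) is the remark preceding Theorem 8.2.1 (whose content is (8.2.12)–(8.2.13)).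

Source of the printed statements: N. Madras, G. Slade, *The Self-Avoiding Walk* (1993), §8.2, Theorem 8.2.1 (book
p. 269; PDF p0281 [436-pp copy `book:madras1993-self-avoiding-walk`] = p0210 [340-pp copy]): "(8.2.11) `μ(R) < μ` …
(8.2.13) `μ(R[k,T]) < μ(R[k,T+1])` for every `T`" — proved there by the Pattern Theorem resp. the renewal identity
(8.2.15)–(8.2.16) (book p. 270); no margin is printed (the slab case `k = d-1` is Hammersley–Whittington 1985).

## Proof (NOT the printed one): the top-edge lift (lane pcv-sawmu item X21; text a-idea-2 ROUTES v4.1 §15, here in a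
## single-level variant)

HEIGHT = the last coordinate; a COLUMN is a line in that direction; the TOP of a column met by the walk `ω` is its
highest point; a TOP EDGE is a step of `ω` joining the tops of two (adjacent) columns at the same height.  Replacing a
top edge `(p,z) → (p',z)` by the detour `(p,z),(p,z+1),…,(p,T+1),(p',T+1),…,(p',z)` keeps the walk self-avoiding (the
new points sit above the tops of their own columns) and inside `R[k,T+1]`.  DENSITY (pointer forest): a column that
lies in no top edge and whose top is not an endpoint of `ω` has a horizontal step from its top to an adjacent column
with STRICTLY higher top; following these pointers one climbs to a column lying in a top edge (or to an endpoint
column) within `T` steps, so every column is within box distance `T` of such a column; counting columns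
(`≥ (n+1)/(T+1)`) gives `≥ n/Q` pairwise column-disjoint top edges at ONE common level `z*` (best level, one parity
class of step indices).  Lifting any subset `M` of this fixed family to height `T+1` costs `2(T+1-z*) ≤ 2T+2` steps per
edge; an image has at most `T+1` preimages (given `z*`, delete the image points above `z*` in the columns that reach
height `T+1`).  Summing `x^{length}` and extracting exactly as in `SAWStripInsertionMargin.lean` gives the floors.
-/

noncomputable section

open Filter Topology Literature.Probability.LatticeModels Literature.Probability.Percolation SimpleGraph
open scoped BigOperators

namespace Literature.Probability.RandomPlanarGeometry.SAW.Zd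

namespace TopLift

variable {d : ℕ}

/-! ### Coordinates: the height `x_{d+1}` in `ℤ^{d+2}` and column bases -/

/-- The height coordinate (the last one). [folklore] -/
private def hI (d : ℕ) : Fin (d + 2) := Fin.last (d + 1)

/-- The value of the height index. [folklore] -/
@[simp] private theorem hI_val (d : ℕ) : (hI d).val = d + 1 := rfl

/-- The vector `b e_{d+1}`. [folklore] -/
private def hvec (d : ℕ) (b : ℤ) : Site (d + 2) := Pi.single (hI d) b

/-- Height of `hvec`. [folklore] -/
@[simp] private theorem hvec_hI (b : ℤ) : hvec d b (hI d) = b := by simp [hvec]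
/-- Other coordinates of `hvec`. [folklore] -/
@[simp] private theorem hvec_ne (b : ℤ) {i : Fin (d + 2)} (h : i ≠ hI d) : hvec d b i = 0 := by simp [hvec, h]
/-- `hvec` is additive. [folklore] -/
private theorem hvec_add (a b : ℤ) : hvec d (a + b) = hvec d a + hvec d b := by simp [hvec, Pi.single_add]
/-- `hvec d 0 = 0`. [folklore] -/
@[simp] private theorem hvec_zero_eq : hvec d 0 = 0 := by simp [hvec]

/-- Adjacency along `e_{d+1}`. [folklore] -/
private theorem adj_add_hvec_one (p : Site (d + 2)) : (zdGraph (d + 2)).Adj p (p + hvec d 1) := by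
  rw [zdGraph_adj_iff]; exact ⟨hI d, Or.inl rfl⟩

/-- The base of a site: the site with its height set to `0` (it names the column). [folklore] -/
private def base (p : Site (d + 2)) : Site (d + 2) := Function.update p (hI d) 0

/-- The height of a base is `0`. [folklore] -/
@[simp] private theorem base_hI (p : Site (d + 2)) : base p (hI d) = 0 := by simp [base]
/-- The other coordinates of a base. [folklore] -/
@[simp] private theorem base_ne (p : Site (d + 2)) {i : Fin (d + 2)} (h : i ≠ hI d) : base p i = p i := by simp [base, h]

/-- Translating along the height does not change the base. [folklore] -/
@[simp] private theorem base_add_hvec (p : Site (d + 2)) (b : ℤ) : base (p + hvec d b) = base p := by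
  funext i; by_cases h : i = hI d
  · subst h; simp
  · simp [h]

/-- A site is its base plus its height. [folklore] -/
private theorem eq_base_add_hvec (p : Site (d + 2)) : p = base p + hvec d (p (hI d)) := by
  funext i; by_cases h : i = hI d
  · subst h; simp
  · simp [h]

/-- Two sites with the same base and height are equal. [folklore] -/
private theorem eq_of_base_eq_of_hI_eq {p q : Site (d + 2)} (hb : base p = base q) (hh : p (hI d) = q (hI d)) : p = q := by
  rw [eq_base_add_hvec p, eq_base_add_hvec q, hb, hh]

/-- Same base means equal coordinates off the height. [folklore] -/
private theorem base_eq_iff {p q : Site (d + 2)} : base p = base q ↔ ∀ i : Fin (d + 2), i ≠ hI d → p i = q i := by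
  constructor
  · intro h i hi; have := congrFun h i; simpa [hi] using this
  · intro h; funext i; by_cases hi : i = hI d
    · subst hi; simp
    · simp [hi, h i hi]

/-- A nearest-neighbour step either keeps the base (a vertical step `± e_{d+1}`) or keeps the height
(a horizontal step to an adjacent base). [folklore] -/
private theorem step_cases {p q : Site (d + 2)} (h : (zdGraph (d + 2)).Adj p q) :
    (base p = base q ∧ (q = p + hvec d 1 ∨ p = q + hvec d 1)) ∨
      (p (hI d) = q (hI d) ∧ base p ≠ base q ∧ (zdGraph (d + 2)).Adj (base p) (base q)) := by
  rw [zdGraph_adj_iff] at h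
  obtain ⟨i, hi⟩ := h
  by_cases hiH : i = hI d
  · subst hiH
    left
    rcases hi with h | h
    · refine ⟨?_, Or.inl h⟩; rw [h]; exact (base_add_hvec p 1).symm
    · refine ⟨?_, Or.inr h⟩; rw [h]; exact base_add_hvec q 1
  · right
    have hh : p (hI d) = q (hI d) := by
      rcases hi with h | h
      · rw [h]; simp [Ne.symm hiH]
      · rw [h]; simp [Ne.symm hiH]
    refine ⟨hh, ?_, ?_⟩
    · intro hb
      have := congrFun hb i
      simp only [base_ne _ hiH] at this
      rcases hi with h | h
      · have h2 := congrFun h i; simp at h2; omega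
      · have h2 := congrFun h i; simp at h2; omega
    · rw [zdGraph_adj_iff]
      refine ⟨i, ?_⟩
      rcases hi with h | h
      · left; funext j
        by_cases hj : j = hI d
        · subst hj; simp [Ne.symm hiH]
        · simp [hj, h]
      · right; funext j
        by_cases hj : j = hI d
        · subst hj; simp [Ne.symm hiH]
        · simp [hj, h]

/-! ### Walks in `R[k,T]`, tops, top edges -/

variable (ω : ℕ → Site (d + 2)) (n : ℕ)

/-- `t` is a top time: no point of the walk in the column of `ω t` is higher. [folklore] -/
private def IsTop (t : ℕ) : Prop := ∀ s ≤ n, base (ω s) = base (ω t) → ω s (hI d) ≤ ω t (hI d)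

/-- `IsTop` is decidable. [folklore] -/
private instance (t : ℕ) : Decidable (IsTop ω n t) := by unfold IsTop; infer_instance

/-- Step `t` is a top edge: both ends are tops, at the same height. [folklore] -/
private def IsTopEdge (t : ℕ) : Prop := IsTop ω n t ∧ IsTop ω n (t + 1) ∧ ω t (hI d) = ω (t + 1) (hI d)

/-- `IsTopEdge` is decidable. [folklore] -/
private instance (t : ℕ) : Decidable (IsTopEdge ω n t) := by unfold IsTopEdge; infer_instance

/-- The top-edge steps at level `z`. [folklore] -/
private def topSteps (z : ℤ) : Finset ℕ := (Finset.range n).filter fun t => IsTopEdge ω n t ∧ ω t (hI d) = z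

/-- All top-edge steps. [folklore] -/
private def allTopSteps : Finset ℕ := (Finset.range n).filter fun t => IsTopEdge ω n t

variable {ω n}

/-- The standing hypotheses: `ω` is an `n`-step self-avoiding nearest-neighbour walk of `R[k,T] ⊂ ℤ^{d+2}`,
`k ≤ d + 1` (so that the height is a confined coordinate). [folklore] -/
private structure RegionWalk (k T : ℕ) (ω : ℕ → Site (d + 2)) (n : ℕ) : Prop where
  adj : ∀ t < n, (zdGraph (d + 2)).Adj (ω t) (ω (t + 1))
  inj : Set.InjOn ω {i | i ≤ n}
  box : ∀ t ≤ n, ∀ i : Fin (d + 2), k ≤ i.val → 0 ≤ ω t i ∧ ω t i ≤ (T : ℤ)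
  hk : k ≤ d + 1

variable {k T : ℕ}

/-- Heights of a region walk lie in `[0, T]`. [folklore] -/
private theorem RegionWalk.height (hW : RegionWalk k T ω n) {t : ℕ} (ht : t ≤ n) :
    0 ≤ ω t (hI d) ∧ ω t (hI d) ≤ (T : ℤ) :=
  hW.box t ht (hI d) (by simpa using hW.hk)

/-- Two tops of the same column are the same vertex, hence the same time. [folklore] -/
private theorem top_unique (hW : RegionWalk k T ω n) {s t : ℕ} (hs : s ≤ n) (ht : t ≤ n) (hS : IsTop ω n s)
    (hT : IsTop ω n t) (hb : base (ω s) = base (ω t)) : s = t := by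
  have h1 := hS t ht hb.symm
  have h2 := hT s hs hb
  exact hW.inj hs ht (eq_of_base_eq_of_hI_eq hb (le_antisymm h2 h1))

/-- A top edge is a horizontal step between adjacent, distinct bases. [folklore] -/
private theorem topEdge_base_ne (hW : RegionWalk k T ω n) {t : ℕ} (ht : t < n) (h : IsTopEdge ω n t) :
    base (ω t) ≠ base (ω (t + 1)) ∧ (zdGraph (d + 2)).Adj (base (ω t)) (base (ω (t + 1))) := by
  rcases step_cases (hW.adj t ht) with ⟨hb, hv⟩ | ⟨-, hne, hadj⟩
  · exfalso
    have := h.2.2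
    rcases hv with e | e
    · have h' := congrFun e (hI d); simp at h'; omega
    · have h' := congrFun e (hI d); simp at h'; omega
  · exact ⟨hne, hadj⟩

/-- Distinct top-edge steps that are not consecutive have four distinct columns; in particular two
top-edge steps of the same parity are column-disjoint. [folklore] -/
private theorem topEdge_cols_disjoint (hW : RegionWalk k T ω n) {t t' : ℕ} (ht : t < n) (ht' : t' < n)
    (h : IsTopEdge ω n t) (h' : IsTopEdge ω n t') (hfar : t + 1 < t' ∨ t' + 1 < t) :
    base (ω t) ≠ base (ω t') ∧ base (ω t) ≠ base (ω (t' + 1)) ∧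
      base (ω (t + 1)) ≠ base (ω t') ∧ base (ω (t + 1)) ≠ base (ω (t' + 1)) := by
  refine ⟨fun hb => ?_, fun hb => ?_, fun hb => ?_, fun hb => ?_⟩
  · have := top_unique hW (by omega) (by omega) h.1 h'.1 hb; omega
  · have := top_unique hW (by omega) (by omega) h.1 h'.2.1 hb; omega
  · have := top_unique hW (by omega) (by omega) h.2.1 h'.1 hb; omega
  · have := top_unique hW (by omega) (by omega) h.2.1 h'.2.1 hb; omega


/-! ### The pointer forest: many column-disjoint top edges at one level -/

/-- The columns (bases) met by `ω` up to time `n`. [folklore] -/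
private def cols (ω : ℕ → Site (d + 2)) (n : ℕ) : Finset (Site (d + 2)) :=
  (Finset.range (n + 1)).image fun t => base (ω t)

/-- The columns lying in a top edge. [folklore] -/
private def colEdge (ω : ℕ → Site (d + 2)) (n : ℕ) : Finset (Site (d + 2)) :=
  (allTopSteps ω n).biUnion fun t => {base (ω t), base (ω (t + 1))}

/-- The columns of the two endpoints. [folklore] -/
private def colEnd (ω : ℕ → Site (d + 2)) (n : ℕ) : Finset (Site (d + 2)) := {base (ω 0), base (ω n)}

/-- Membership in `allTopSteps`. [folklore] -/
private theorem mem_allTopSteps {t : ℕ} : t ∈ allTopSteps ω n ↔ t < n ∧ IsTopEdge ω n t := by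
  simp [allTopSteps]

/-- Membership in `topSteps`. [folklore] -/
private theorem mem_topSteps {z : ℤ} {t : ℕ} : t ∈ topSteps ω n z ↔ t < n ∧ IsTopEdge ω n t ∧ ω t (hI d) = z := by
  simp [topSteps]

/-- Every met column has a top time. [folklore] -/
private theorem exists_top {s : ℕ} (hs : s ≤ n) : ∃ t ≤ n, base (ω t) = base (ω s) ∧ IsTop ω n t := by
  obtain ⟨t, ht, hmax⟩ := Finset.exists_max_image
    ((Finset.range (n + 1)).filter fun t => base (ω t) = base (ω s)) (fun t => ω t (hI d))
    ⟨s, Finset.mem_filter.2 ⟨Finset.mem_range.2 (Nat.lt_succ_of_le hs), rfl⟩⟩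
  obtain ⟨ht1, ht2⟩ := Finset.mem_filter.1 ht
  refine ⟨t, Nat.le_of_lt_succ (Finset.mem_range.1 ht1), ht2, fun u hu hb => ?_⟩
  exact hmax u (Finset.mem_filter.2 ⟨Finset.mem_range.2 (Nat.lt_succ_of_le hu), hb.trans ht2⟩)

/-- **The pointer.** The top of a column that lies in no top edge and is visited at an interior time has
a horizontal step to an adjacent column whose top is strictly higher. [folklore] -/
private theorem exists_pointer (hW : RegionWalk k T ω n) {t : ℕ} (ht0 : 0 < t) (htn : t < n) (htop : IsTop ω n t)
    (hne : base (ω t) ∉ colEdge ω n) :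
    ∃ u ≤ n, IsTop ω n u ∧ (zdGraph (d + 2)).Adj (base (ω t)) (base (ω u)) ∧ ω t (hI d) < ω u (hI d) := by
  -- one of the two steps at `ω t` is horizontal
  have hhor : ∃ t', (t' = t - 1 ∨ t' = t + 1) ∧ ω t' (hI d) = ω t (hI d) ∧ base (ω t') ≠ base (ω t) ∧
      (zdGraph (d + 2)).Adj (base (ω t)) (base (ω t')) := by
    have h1 := hW.adj (t - 1) (by omega)
    rw [show t - 1 + 1 = t by omega] at h1
    have h2 := hW.adj t htn
    rcases step_cases h2 with ⟨hb2, hv2⟩ | ⟨hh2, hb2, ha2⟩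
    · rcases step_cases h1 with ⟨hb1, hv1⟩ | ⟨hh1, hb1, ha1⟩
      · exfalso
        -- both steps vertical: the up-steps are excluded by `IsTop`, two down-steps collide
        rcases hv2 with e2 | e2
        · have := htop (t + 1) (by omega) hb2.symm
          have h' := congrFun e2 (hI d); simp at h'; omega
        · rcases hv1 with e1 | e1
          · -- ω t = ω (t-1) + e, and ω t = ω (t+1) + e ⇒ ω (t-1) = ω (t+1)
            have : ω (t - 1) = ω (t + 1) := by
              have := e1.symm.trans e2; exact add_right_cancel this
            have := hW.inj (show t - 1 ≤ n by omega) (show t + 1 ≤ n by omega) this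
            omega
          · have := htop (t - 1) (by omega) hb1
            have h' := congrFun e1 (hI d); simp at h'; omega
      · exact ⟨t - 1, Or.inl rfl, hh1, fun h => hb1 h, by rw [(zdGraph (d + 2)).adj_comm]; exact ha1⟩
    · exact ⟨t + 1, Or.inr rfl, hh2.symm, fun h => hb2 h.symm, ha2⟩
  obtain ⟨t', ht', hh, hb, hadj⟩ := hhor
  have ht'n : t' ≤ n := by omega
  obtain ⟨u, hun, hbu, hutop⟩ := exists_top (ω := ω) ht'n
  refine ⟨u, hun, hutop, by rw [hbu]; exact hadj, ?_⟩
  have hle : ω t (hI d) ≤ ω u (hI d) := by rw [← hh]; exact hutop t' ht'n hbu.symm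
  rcases hle.lt_or_eq with hlt | heq
  · exact hlt
  · exfalso
    -- then `ω t'` is itself a top and the step is a top edge
    have ht'top : IsTop ω n t' := fun s hs hbs => by
      rw [hh, heq]; exact hutop s hs (hbs.trans hbu.symm)
    apply hne
    rw [colEdge, Finset.mem_biUnion]
    rcases ht' with rfl | rfl
    · have e : t - 1 + 1 = t := by omega
      refine ⟨t - 1, mem_allTopSteps.2 ⟨by omega, ht'top, by rw [e]; exact htop, by rw [e]; exact hh⟩, ?_⟩
      simp [e]
    · exact ⟨t, mem_allTopSteps.2 ⟨htn, htop, ht'top, hh.symm⟩, by simp⟩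

/-- Adjacent sites differ by at most one in every coordinate. [folklore] -/
private theorem abs_sub_le_one_of_adj' {p q : Site (d + 2)} (h : (zdGraph (d + 2)).Adj p q) (i : Fin (d + 2)) :
    |p i - q i| ≤ 1 := by
  rw [abs_sub_comm]; exact abs_sub_le_one_of_adj h i

/-- **Climbing.** From the top of every column one reaches, within box distance `(top there) − (top here) ≤ T`,
a column that lies in a top edge or is an endpoint column. [folklore] -/
private theorem exists_root (hW : RegionWalk k T ω n) :
    ∀ m : ℕ, ∀ t ≤ n, IsTop ω n t → (T : ℤ) - ω t (hI d) ≤ m →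
      ∃ r ≤ n, base (ω r) ∈ colEdge ω n ∪ colEnd ω n ∧
        ∀ i : Fin (d + 2), |base (ω t) i - base (ω r) i| ≤ ω r (hI d) - ω t (hI d)
  | 0, t, ht, htop, hm => by
    by_cases hmem : base (ω t) ∈ colEdge ω n ∪ colEnd ω n
    · exact ⟨t, ht, hmem, fun i => by simp⟩
    · exfalso
      rw [Finset.mem_union, not_or] at hmem
      have ht0 : 0 < t := by
        by_contra h; apply hmem.2; rw [show t = 0 by omega]; simp [colEnd]
      have htn : t < n := by
        by_contra h; apply hmem.2; rw [show t = n by omega]; simp [colEnd]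
      obtain ⟨u, hun, -, -, hlt⟩ := exists_pointer hW ht0 htn htop hmem.1
      have := (hW.height hun).2
      omega
  | m + 1, t, ht, htop, hm => by
    by_cases hmem : base (ω t) ∈ colEdge ω n ∪ colEnd ω n
    · exact ⟨t, ht, hmem, fun i => by simp⟩
    · rw [Finset.mem_union, not_or] at hmem
      have ht0 : 0 < t := by
        by_contra h; apply hmem.2; rw [show t = 0 by omega]; simp [colEnd]
      have htn : t < n := by
        by_contra h; apply hmem.2; rw [show t = n by omega]; simp [colEnd]
      obtain ⟨u, hun, hutop, hadj, hlt⟩ := exists_pointer hW ht0 htn htop hmem.1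
      obtain ⟨r, hrn, hr, hdist⟩ := exists_root hW m u hun hutop (by omega)
      refine ⟨r, hrn, hr, fun i => ?_⟩
      have h1 := abs_sub_le_one_of_adj' hadj i
      have h2 := hdist i
      calc |base (ω t) i - base (ω r) i|
          = |(base (ω t) i - base (ω u) i) + (base (ω u) i - base (ω r) i)| := by ring_nf
        _ ≤ |base (ω t) i - base (ω u) i| + |base (ω u) i - base (ω r) i| := abs_add_le _ _
        _ ≤ ω r (hI d) - ω t (hI d) := by linarith

/-- The box of bases within distance `T` of the base `r`. [folklore] -/
private def ball (T : ℕ) (r : Site (d + 2)) : Finset (Site (d + 2)) :=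
  Fintype.piFinset fun i : Fin (d + 2) => if i = hI d then {0} else Finset.Icc (r i - T) (r i + T)

/-- Membership in the box. [folklore] -/
private theorem mem_ball {T : ℕ} {r b : Site (d + 2)} (hb : b (hI d) = 0) (h : ∀ i, |b i - r i| ≤ (T : ℤ)) :
    b ∈ ball T r := by
  rw [ball, Fintype.mem_piFinset]
  intro i
  by_cases hi : i = hI d
  · subst hi; simp [hb]
  · rw [if_neg hi, Finset.mem_Icc]
    have := h i; rw [abs_le] at this; constructor <;> omega

/-- The box has `(2T+1)^{d+1}` bases. [folklore] -/
private theorem card_ball (T : ℕ) (r : Site (d + 2)) : (ball T r).card = (2 * T + 1) ^ (d + 1) := by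
  rw [ball, Fintype.card_piFinset]
  have : ∀ i : Fin (d + 2), (if i = hI d then ({0} : Finset ℤ) else Finset.Icc (r i - T) (r i + T)).card =
      if i = hI d then 1 else 2 * T + 1 := by
    intro i; split_ifs
    · rfl
    · rw [Int.card_Icc]; omega
  simp_rw [this]
  rw [Finset.prod_ite, Finset.prod_const_one, one_mul, Finset.prod_const]
  congr 1
  rw [Finset.filter_ne', Finset.card_erase_of_mem (Finset.mem_univ _), Finset.card_univ, Fintype.card_fin]
  rfl

/-- **Column count.** `#cols ≤ (#colEdge + 2) · (2T+1)^{d+1}`. [folklore] -/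
private theorem card_cols_le (hW : RegionWalk k T ω n) :
    (cols ω n).card ≤ ((colEdge ω n).card + 2) * (2 * T + 1) ^ (d + 1) := by
  have hsub : cols ω n ⊆ (colEdge ω n ∪ colEnd ω n).biUnion (ball T) := by
    intro b hb
    obtain ⟨s, hs, rfl⟩ := Finset.mem_image.1 hb
    have hsn : s ≤ n := Nat.le_of_lt_succ (Finset.mem_range.1 hs)
    obtain ⟨t, htn, hbt, htop⟩ := exists_top (ω := ω) hsn
    obtain ⟨r, hrn, hr, hdist⟩ := exists_root hW T t htn htop (by have := (hW.height htn).1; omega)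
    rw [Finset.mem_biUnion]
    refine ⟨base (ω r), hr, ?_⟩
    rw [← hbt]
    refine mem_ball (base_hI _) fun i => (hdist i).trans ?_
    have := (hW.height hrn).2; have := (hW.height htn).1; omega
  calc (cols ω n).card ≤ ((colEdge ω n ∪ colEnd ω n).biUnion (ball T)).card := Finset.card_le_card hsub
    _ ≤ ∑ r ∈ colEdge ω n ∪ colEnd ω n, (ball T r).card := Finset.card_biUnion_le
    _ = (colEdge ω n ∪ colEnd ω n).card * (2 * T + 1) ^ (d + 1) := by
        simp_rw [card_ball]; rw [Finset.sum_const, smul_eq_mul]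
    _ ≤ ((colEdge ω n).card + 2) * (2 * T + 1) ^ (d + 1) := by
        refine Nat.mul_le_mul_right _ ((Finset.card_union_le _ _).trans (Nat.add_le_add_left ?_ _))
        exact Finset.card_le_two

/-- `#colEdge ≤ 2 · #allTopSteps`. [folklore] -/
private theorem card_colEdge_le (ω : ℕ → Site (d + 2)) (n : ℕ) :
    (colEdge ω n).card ≤ 2 * (allTopSteps ω n).card := by
  rw [colEdge, mul_comm]
  refine Finset.card_biUnion_le.trans ?_
  rw [← smul_eq_mul, ← Finset.sum_const]
  exact Finset.sum_le_sum fun t _ => Finset.card_le_two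

/-- Pigeonhole on columns: `n + 1 ≤ #cols · (T + 1)`. [folklore] -/
private theorem succ_le_card_cols_mul (hW : RegionWalk k T ω n) : n + 1 ≤ (cols ω n).card * (T + 1) := by
  have h := Finset.card_le_card_of_injOn (s := Finset.range (n + 1))
    (t := cols ω n ×ˢ Finset.range (T + 1)) (fun t => (base (ω t), (ω t (hI d)).toNat)) (fun t ht => ?_)
    (fun t ht t' ht' h => ?_)
  · simpa using h
  · have ht' : t ≤ n := by simpa [Nat.lt_succ_iff] using ht
    simp only [Finset.coe_product, Finset.coe_range, Set.mem_prod, Finset.mem_coe, Set.mem_Iio]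
    refine ⟨Finset.mem_image.2 ⟨t, by simpa using ht, rfl⟩, ?_⟩
    have := hW.height ht'; omega
  · have htn : t ≤ n := by simpa [Nat.lt_succ_iff] using ht
    have htn' : t' ≤ n := by simpa [Nat.lt_succ_iff] using ht'
    simp only [Prod.mk.injEq] at h
    have h0 := (hW.height htn).1; have h0' := (hW.height htn').1
    exact hW.inj htn htn' (eq_of_base_eq_of_hI_eq h.1 (by omega))

/-- The top-edge steps split by level `z ∈ {0,…,T}`: `#allTopSteps ≤ (T+1) · max_z #topSteps z`, so some level
carries at least the average. [folklore] -/
private theorem exists_level (hW : RegionWalk k T ω n) :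
    ∃ z : ℕ, z ≤ T ∧ (allTopSteps ω n).card ≤ (T + 1) * (topSteps ω n z).card := by
  obtain ⟨z, hz, hmax⟩ := Finset.exists_max_image (Finset.range (T + 1))
    (fun z : ℕ => (topSteps ω n z).card) ⟨0, by simp⟩
  refine ⟨z, Nat.le_of_lt_succ (Finset.mem_range.1 hz), ?_⟩
  have hcover : allTopSteps ω n ⊆ (Finset.range (T + 1)).biUnion fun z : ℕ => topSteps ω n z := by
    intro t ht
    obtain ⟨htn, hte⟩ := mem_allTopSteps.1 ht
    have hh := hW.height htn.le
    rw [Finset.mem_biUnion]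
    refine ⟨(ω t (hI d)).toNat, Finset.mem_range.2 (by omega), mem_topSteps.2 ⟨htn, hte, by omega⟩⟩
  calc (allTopSteps ω n).card ≤ ((Finset.range (T + 1)).biUnion fun z : ℕ => topSteps ω n z).card :=
        Finset.card_le_card hcover
    _ ≤ ∑ z ∈ Finset.range (T + 1), (topSteps ω n z).card := Finset.card_biUnion_le
    _ ≤ ∑ _z ∈ Finset.range (T + 1), (topSteps ω n z).card := Finset.sum_le_sum fun z' hz' => hmax z' hz'
    _ = (T + 1) * (topSteps ω n z).card := by rw [Finset.sum_const, Finset.card_range, smul_eq_mul]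

/-- The denominator `Q = 4 (T+1)² (2T+1)^{d+1}`. [folklore] -/
private def Q (d T : ℕ) : ℕ := 4 * (T + 1) ^ 2 * (2 * T + 1) ^ (d + 1)

/-- **Density.** Some level carries, in one parity class of step indices, at least `n / Q` top-edge steps.
[folklore] -/
private theorem exists_level_parity (hW : RegionWalk k T ω n) :
    ∃ z : ℕ, z ≤ T ∧ ∃ b : ℕ, b < 2 ∧ n / Q d T ≤ ((topSteps ω n z).filter fun t => t % 2 = b).card := by
  obtain ⟨z, hzT, hz⟩ := exists_level hW
  set S := topSteps ω n z with hS
  -- the larger parity class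
  have hsplit : S.card = (S.filter fun t => t % 2 = 0).card + (S.filter fun t => t % 2 = 1).card := by
    rw [← Finset.card_union_of_disjoint]
    · congr 1; ext t; simp only [Finset.mem_union, Finset.mem_filter]; constructor
      · intro h; rcases Nat.mod_two_eq_zero_or_one t with h' | h'
        · exact Or.inl ⟨h, h'⟩
        · exact Or.inr ⟨h, h'⟩
      · rintro (⟨h, -⟩ | ⟨h, -⟩) <;> exact h
    · rw [Finset.disjoint_filter]; intro t _ h; omega
  obtain ⟨b, hb2, hb⟩ : ∃ b : ℕ, b < 2 ∧ S.card ≤ 2 * (S.filter fun t => t % 2 = b).card := by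
    by_cases h : (S.filter fun t => t % 2 = 1).card ≤ (S.filter fun t => t % 2 = 0).card
    · exact ⟨0, by omega, by omega⟩
    · exact ⟨1, by omega, by omega⟩
  refine ⟨z, hzT, b, hb2, ?_⟩
  set P := (S.filter fun t => t % 2 = b).card with hP
  have h1 := succ_le_card_cols_mul hW
  have h2 := card_cols_le hW
  have h3 := card_colEdge_le ω n
  set β := (2 * T + 1) ^ (d + 1) with hβ
  have hβ1 : 1 ≤ β := Nat.one_le_pow _ _ (by omega)
  -- n + 1 ≤ (T+1) β (2 (T+1) 2P + 2) ≤ Q (P + 1)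
  have h4 : n + 1 ≤ Q d T * (P + 1) := by
    have e0 : (colEdge ω n).card ≤ 2 * ((T + 1) * (2 * P)) :=
      h3.trans (Nat.mul_le_mul_left 2 (hz.trans (Nat.mul_le_mul_left _ hb)))
    have e1 : (cols ω n).card ≤ (2 * ((T + 1) * (2 * P)) + 2) * β :=
      h2.trans (Nat.mul_le_mul_right _ (by omega))
    have e2 : n + 1 ≤ (2 * ((T + 1) * (2 * P)) + 2) * β * (T + 1) :=
      h1.trans (Nat.mul_le_mul_right _ e1)
    have hQβ : Q d T = 4 * (T + 1) ^ 2 * β := by rw [Q, hβ]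
    have e3 : (2 * ((T + 1) * (2 * P)) + 2) * β * (T + 1) ≤ 4 * (T + 1) ^ 2 * β * (P + 1) := by
      have h5 : 2 * β * (T + 1) ≤ 4 * (T + 1) ^ 2 * β := by nlinarith [hβ1]
      nlinarith [h5]
    rw [hQβ]
    exact e2.trans e3
  have hQ : 0 < Q d T := by rw [Q]; positivity
  by_contra hlt
  rw [not_le] at hlt
  have : Q d T * (P + 1) ≤ Q d T * (n / Q d T) := Nat.mul_le_mul_left _ hlt
  have := Nat.div_mul_le_self n (Q d T)
  rw [mul_comm] at this
  omega


/-! ### The fixed family `M₀(ω)` of column-disjoint top edges at one level -/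

/-- "Some level and parity class carry at least `n/Q` top-edge steps" (true for region walks). [folklore] -/
private def GoodPair (T : ℕ) (ω : ℕ → Site (d + 2)) (n : ℕ) : Prop :=
  ∃ z : ℕ, z ≤ T ∧ ∃ b : ℕ, b < 2 ∧ n / Q d T ≤ ((topSteps ω n z).filter fun t => t % 2 = b).card

open Classical in
/-- The chosen level `z*` (`≤ T`). [folklore] -/
private def zOf (T : ℕ) (ω : ℕ → Site (d + 2)) (n : ℕ) : ℕ :=
  if h : GoodPair T ω n then Classical.choose h else 0

open Classical in
/-- The chosen parity. [folklore] -/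
private def bOf (T : ℕ) (ω : ℕ → Site (d + 2)) (n : ℕ) : ℕ :=
  if h : GoodPair T ω n then Classical.choose (Classical.choose_spec h).2 else 0

/-- The candidate steps: top edges at level `z*` with step index of parity `b*`. [folklore] -/
private def cand (T : ℕ) (ω : ℕ → Site (d + 2)) (n : ℕ) : Finset ℕ :=
  (topSteps ω n (zOf T ω n)).filter fun t => t % 2 = bOf T ω n

open Classical in
/-- The fixed family `M₀(ω)`: `n / Q` candidate steps (empty if there are too few). [folklore] -/
private def M0 (T : ℕ) (ω : ℕ → Site (d + 2)) (n : ℕ) : Finset ℕ :=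
  if h : n / Q d T ≤ (cand T ω n).card then Classical.choose (Finset.exists_subset_card_eq h) else ∅

/-- The lift height `h = T + 1 − z*` (at least `1`). [folklore] -/
private def liftH (T : ℕ) (ω : ℕ → Site (d + 2)) (n : ℕ) : ℕ := T - zOf T ω n + 1

/-- `z* ≤ T`. [folklore] -/
private theorem zOf_le (T : ℕ) (ω : ℕ → Site (d + 2)) (n : ℕ) : zOf T ω n ≤ T := by
  unfold zOf; split_ifs with h
  · exact (Classical.choose_spec h).1
  · exact Nat.zero_le _

/-- `z* + h = T + 1`. [folklore] -/
private theorem zOf_add_liftH (T : ℕ) (ω : ℕ → Site (d + 2)) (n : ℕ) : zOf T ω n + liftH T ω n = T + 1 := by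
  have := zOf_le T ω n; unfold liftH; omega

/-- For a region walk the candidates are many. [folklore] -/
private theorem div_le_card_cand (hW : RegionWalk k T ω n) : n / Q d T ≤ (cand T ω n).card := by
  have hg : GoodPair T ω n := exists_level_parity hW
  have h1 := Classical.choose_spec hg
  have h2 := Classical.choose_spec h1.2
  unfold cand zOf bOf
  rw [dif_pos hg, dif_pos hg]
  exact h2.2

/-- `M₀ ⊆ cand`. [folklore] -/
private theorem M0_subset (T : ℕ) (ω : ℕ → Site (d + 2)) (n : ℕ) : M0 T ω n ⊆ cand T ω n := by
  unfold M0; split_ifs with h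
  · exact (Classical.choose_spec (Finset.exists_subset_card_eq h)).1
  · exact Finset.empty_subset _

/-- `#M₀ = n / Q` for a region walk. [folklore] -/
private theorem card_M0 (hW : RegionWalk k T ω n) : (M0 T ω n).card = n / Q d T := by
  have h := div_le_card_cand hW
  unfold M0; rw [dif_pos h]
  exact (Classical.choose_spec (Finset.exists_subset_card_eq h)).2

/-- What a member of `M₀` is: a top-edge step `< n` at level `z*`. [folklore] -/
private theorem mem_M0 {t : ℕ} (ht : t ∈ M0 T ω n) :
    t < n ∧ IsTopEdge ω n t ∧ ω t (hI d) = zOf T ω n ∧ t % 2 = bOf T ω n := by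
  have h := M0_subset T ω n ht
  unfold cand at h
  rw [Finset.mem_filter, mem_topSteps] at h
  exact ⟨h.1.1, h.1.2.1, h.1.2.2, h.2⟩

/-- Distinct members of `M₀` are at least two apart. [folklore] -/
private theorem far_of_mem_M0 {t t' : ℕ} (ht : t ∈ M0 T ω n) (ht' : t' ∈ M0 T ω n) (hne : t ≠ t') :
    t + 1 < t' ∨ t' + 1 < t := by
  have h1 := (mem_M0 ht).2.2.2
  have h2 := (mem_M0 ht').2.2.2
  omega

/-! ### The lift surgery -/

/-- The block of step `t`: for `t ∈ M` the detour up the column of `ω t`, down the column of `ω (t+1)`;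
otherwise just `ω t`. [folklore] -/
private def block (h : ℕ) (M : Finset ℕ) (ω : ℕ → Site (d + 2)) (t : ℕ) : List (Site (d + 2)) :=
  if t ∈ M then
    ω t :: (((List.range h).map fun j : ℕ => ω t + hvec d ((j : ℤ) + 1)) ++
      ((List.range h).map fun j : ℕ => ω (t + 1) + hvec d ((j : ℤ) + 1)).reverse)
  else [ω t]

/-- The image list. [folklore] -/
private def imageList (h : ℕ) (M : Finset ℕ) (ω : ℕ → Site (d + 2)) (n : ℕ) : List (Site (d + 2)) :=
  (List.range n).flatMap (block h M ω) ++ [ω n]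

/-- Blocks are non-empty. [folklore] -/
private theorem block_ne_nil (h : ℕ) (M : Finset ℕ) (ω : ℕ → Site (d + 2)) (t : ℕ) : block h M ω t ≠ [] := by
  unfold block; split_ifs <;> simp

/-- Every block starts with the anchor `ω t`. [folklore] -/
private theorem head?_block (h : ℕ) (M : Finset ℕ) (ω : ℕ → Site (d + 2)) (t : ℕ) :
    (block h M ω t).head? = some (ω t) := by
  unfold block; split_ifs <;> simp

/-- The length of a block. [folklore] -/
private theorem length_block (h : ℕ) (M : Finset ℕ) (ω : ℕ → Site (d + 2)) (t : ℕ) :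
    (block h M ω t).length = 1 + if t ∈ M then 2 * h else 0 := by
  unfold block; split_ifs <;> simp; ring

/-- A list sum over `range` is a `Finset` sum. [folklore] -/
private theorem list_sum_map_range {A : Type*} [AddCommMonoid A] (f : ℕ → A) :
    ∀ n : ℕ, ((List.range n).map f).sum = ∑ t ∈ Finset.range n, f t
  | 0 => by simp
  | n + 1 => by
    rw [List.range_succ, List.map_append, List.sum_append, list_sum_map_range f n,
      Finset.sum_range_succ]
    simp

/-- **Length of the image**: `n + 1 + 2h·#M` points (for `M ⊆ {0,…,n-1}`). [folklore] -/
private theorem length_imageList (h : ℕ) {M : Finset ℕ} (hM : ∀ t ∈ M, t < n) (ω : ℕ → Site (d + 2)) :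
    (imageList h M ω n).length = n + 1 + 2 * h * M.card := by
  rw [imageList, List.length_append, List.length_singleton, List.length_flatMap, list_sum_map_range]
  simp_rw [length_block]
  rw [Finset.sum_add_distrib, Finset.sum_const, Finset.card_range, smul_eq_mul, mul_one,
    ← Finset.sum_filter, Finset.sum_const, smul_eq_mul]
  have : (Finset.range n).filter (fun t => t ∈ M) = M := by
    ext t; simp only [Finset.mem_filter, Finset.mem_range]
    exact ⟨fun h => h.2, fun h => ⟨hM t h, h⟩⟩
  rw [this]; ring

/-- Where the points of a block live. [folklore] -/
private theorem mem_block {h : ℕ} {M : Finset ℕ} {t : ℕ} {v : Site (d + 2)} (hv : v ∈ block h M ω t) :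
    v = ω t ∨ (t ∈ M ∧ (base v = base (ω t) ∧ ω t (hI d) < v (hI d) ∧ v (hI d) ≤ ω t (hI d) + h ∨
      base v = base (ω (t + 1)) ∧ ω (t + 1) (hI d) < v (hI d) ∧ v (hI d) ≤ ω (t + 1) (hI d) + h)) := by
  unfold block at hv
  split_ifs at hv with htM
  · rw [List.mem_cons, List.mem_append, List.mem_reverse, List.mem_map, List.mem_map] at hv
    rcases hv with rfl | ⟨j, hj, rfl⟩ | ⟨j, hj, rfl⟩
    · exact Or.inl rfl
    · rw [List.mem_range] at hj
      exact Or.inr ⟨htM, Or.inl ⟨base_add_hvec _ _, by simp, by simp; omega⟩⟩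
    · rw [List.mem_range] at hj
      exact Or.inr ⟨htM, Or.inr ⟨base_add_hvec _ _, by simp, by simp; omega⟩⟩
  · rw [List.mem_singleton] at hv; exact Or.inl hv

section Image

variable {M : Finset ℕ}

/-- A walk point in a lifted column is not above the level `z*`. [folklore] -/
private theorem height_le_of_base_eq (hM : M ⊆ M0 T ω n) {s t : ℕ} (hs : s ≤ n) (ht : t ∈ M)
    (hb : base (ω s) = base (ω t) ∨ base (ω s) = base (ω (t + 1))) :
    ω s (hI d) ≤ (zOf T ω n : ℤ) := by
  obtain ⟨-, hte, hz, -⟩ := mem_M0 (hM ht)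
  rcases hb with hb | hb
  · rw [← hz]; exact hte.1 s hs hb
  · rw [← hz, hte.2.2]; exact hte.2.1 s hs hb

/-- Each block is duplicate-free. [folklore] -/
private theorem nodup_block (hW : RegionWalk k T ω n) (hM : M ⊆ M0 T ω n) (h : ℕ) {t : ℕ} (ht : t < n) :
    (block h M ω t).Nodup := by
  unfold block
  split_ifs with htM
  · have hbne := (topEdge_base_ne hW ht (mem_M0 (hM htM)).2.1).1
    rw [List.nodup_cons, List.nodup_append]
    refine ⟨?_, ?_, ?_, ?_⟩
    · intro hmem
      rw [List.mem_append, List.mem_reverse, List.mem_map, List.mem_map] at hmem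
      rcases hmem with ⟨j, -, hj⟩ | ⟨j, -, hj⟩
      · have := congrFun hj (hI d); simp at this; omega
      · have := congrFun hj (hI d); simp at this
        have := (mem_M0 (hM htM)).2.1.2.2; omega
    · refine List.Nodup.map (fun i j hij => ?_) List.nodup_range
      have := congrFun hij (hI d); simp at this; omega
    · rw [List.nodup_reverse]
      refine List.Nodup.map (fun i j hij => ?_) List.nodup_range
      have := congrFun hij (hI d); simp at this; omega
    · intro v hv v' hv' hvv
      rw [List.mem_map] at hv
      rw [List.mem_reverse, List.mem_map] at hv'
      obtain ⟨j, -, rfl⟩ := hv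
      obtain ⟨j', -, rfl⟩ := hv'
      apply hbne
      have := congrArg base hvv
      simpa using this
  · exact List.nodup_singleton _

/-- An inserted point is not a point of the walk. [folklore] -/
private theorem ne_anchor (hM : M ⊆ M0 T ω n) (h : ℕ) {t s : ℕ} (hs : s ≤ n) {v : Site (d + 2)}
    (hv : v ∈ block h M ω t) (hvt : v ≠ ω t) : v ≠ ω s := by
  rcases mem_block hv with h' | ⟨htM, hcase⟩
  · exact absurd h' hvt
  · rintro rfl
    obtain ⟨-, -, hz, -⟩ := mem_M0 (hM htM)
    have hz' : ω (t + 1) (hI d) = zOf T ω n := by rw [← (mem_M0 (hM htM)).2.1.2.2, hz]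
    rcases hcase with ⟨hb, hlt, -⟩ | ⟨hb, hlt, -⟩
    · have := height_le_of_base_eq hM hs htM (Or.inl hb); omega
    · have := height_le_of_base_eq hM hs htM (Or.inr hb); omega

/-- Distinct blocks are disjoint. [folklore] -/
private theorem disjoint_block (hW : RegionWalk k T ω n) (hM : M ⊆ M0 T ω n) (h : ℕ) {t t' : ℕ} (ht : t < n)
    (ht' : t' < n) (htt : t ≠ t') : List.Disjoint (block h M ω t) (block h M ω t') := by
  intro v hv hv'
  by_cases hvt : v = ω t
  · -- `v` is the anchor of block `t`
    by_cases hvt' : v = ω t'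
    · exact htt (hW.inj (by show t ≤ n; omega) (by show t' ≤ n; omega) (hvt.symm.trans hvt'))
    · exact ne_anchor hM h (by omega : t ≤ n) hv' hvt' hvt
  · by_cases hvt' : v = ω t'
    · exact ne_anchor hM h (by omega : t' ≤ n) hv hvt hvt'
    · -- two inserted points of different steps: their columns differ
      rcases mem_block hv with h1 | ⟨htM, hc⟩
      · exact hvt h1
      rcases mem_block hv' with h2 | ⟨htM', hc'⟩
      · exact hvt' h2
      have hfar := far_of_mem_M0 (hM htM) (hM htM') htt
      obtain ⟨d1, d2, d3, d4⟩ := topEdge_cols_disjoint hW ht ht' (mem_M0 (hM htM)).2.1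
        (mem_M0 (hM htM')).2.1 hfar
      rcases hc with ⟨hb, -, -⟩ | ⟨hb, -, -⟩ <;> rcases hc' with ⟨hb', -, -⟩ | ⟨hb', -, -⟩
      · exact d1 (hb.symm.trans hb')
      · exact d2 (hb.symm.trans hb')
      · exact d3 (hb.symm.trans hb')
      · exact d4 (hb.symm.trans hb')

/-- **The image list has no repeated point.** [folklore] -/
private theorem nodup_imageList (hW : RegionWalk k T ω n) (hM : M ⊆ M0 T ω n) (h : ℕ) :
    (imageList h M ω n).Nodup := by
  rw [imageList, List.nodup_append]
  refine ⟨?_, List.nodup_singleton _, ?_⟩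
  · rw [List.nodup_flatMap]
    refine ⟨fun t ht => nodup_block hW hM h (List.mem_range.1 ht), ?_⟩
    exact List.pairwise_lt_range.imp_of_mem fun {t t'} ht ht' hlt =>
      disjoint_block hW hM h (List.mem_range.1 ht) (List.mem_range.1 ht') hlt.ne
  · intro v hv v' hv' hvv
    rw [List.mem_singleton] at hv'
    subst hvv; subst hv'
    obtain ⟨t, ht, hvt⟩ := List.mem_flatMap.1 hv
    have htn := List.mem_range.1 ht
    by_cases hva : ω n = ω t
    · have := hW.inj (show n ≤ n from le_rfl) (show t ≤ n by omega) hva; omega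
    · exact ne_anchor hM h le_rfl hvt hva rfl

/-- A `map` over `range` is a chain when consecutive values are related. [folklore] -/
private theorem isChain_map_range {α : Type*} {S : α → α → Prop} (f : ℕ → α) (m : ℕ)
    (hc : ∀ j, j + 1 < m → S (f j) (f (j + 1))) : ((List.range m).map f).IsChain S := by
  rw [List.isChain_map]
  cases m with
  | zero => simp
  | succ m => exact (List.isChain_range_succ _ m).2 fun j hj => hc j (by omega)

/-- The head of `(range (m+1)).map f`. [folklore] -/
private theorem head?_map_range_succ {α : Type*} (f : ℕ → α) (m : ℕ) :
    ((List.range (m + 1)).map f).head? = some (f 0) := by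
  rw [List.range_succ_eq_map]; rfl

/-- The last element of `(range (m+1)).map f`. [folklore] -/
private theorem getLast?_map_range_succ {α : Type*} (f : ℕ → α) (m : ℕ) :
    ((List.range (m + 1)).map f).getLast? = some (f m) := by
  rw [List.range_succ, List.map_append, List.map_singleton, List.getLast?_append,
    List.getLast?_singleton, Option.some_or]

/-- Each block is a nearest-neighbour chain (for `h ≥ 1`). [folklore] -/
private theorem isChain_block (hW : RegionWalk k T ω n) (h' : ℕ) {t : ℕ} (ht : t < n) :
    (block (h' + 1) M ω t).IsChain (zdGraph (d + 2)).Adj := by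
  unfold block
  split_ifs with htM
  · rw [List.isChain_cons]
    refine ⟨?_, ?_⟩
    · intro y hy
      rw [List.head?_append, head?_map_range_succ, Option.some_or, Option.mem_def, Option.some.injEq] at hy
      subst hy; simpa using adj_add_hvec_one (ω t)
    · refine List.IsChain.append ?_ ?_ ?_
      · exact isChain_map_range _ _ fun j _ => by
          have e : ω t + hvec d (((j + 1 : ℕ) : ℤ) + 1) = ω t + hvec d ((j : ℤ) + 1) + hvec d 1 := by
            push_cast; rw [hvec_add, add_assoc]
          rw [e]; exact adj_add_hvec_one _
      · rw [← List.map_reverse, List.isChain_map, List.isChain_reverse,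
          ← List.isChain_map (f := fun j : ℕ => ω (t + 1) + hvec d ((j : ℤ) + 1))
            (R := fun a b => (zdGraph (d + 2)).Adj b a)]
        exact isChain_map_range _ _ fun j _ => by
          show (zdGraph (d + 2)).Adj _ _
          have e : ω (t + 1) + hvec d (((j + 1 : ℕ) : ℤ) + 1) = ω (t + 1) + hvec d ((j : ℤ) + 1) + hvec d 1 := by
            push_cast; rw [hvec_add, add_assoc]
          rw [e]; exact (adj_add_hvec_one _).symm
      · intro a ha b hb
        rw [getLast?_map_range_succ, Option.mem_def, Option.some.injEq] at ha
        rw [← List.map_reverse, List.head?_map, List.head?_reverse, List.getLast?_range,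
          Nat.add_sub_cancel] at hb
        simp only [Nat.add_eq_zero_iff, one_ne_zero, and_false, ↓reduceIte, Option.map_some,
          Option.mem_def, Option.some.injEq] at hb
        subst ha; subst hb
        rw [zdGraph_adj_add_right]
        exact hW.adj t ht
  · exact List.isChain_singleton _

/-- The last point of a block is adjacent to the next anchor (for `h ≥ 1`). [folklore] -/
private theorem getLast_block_adj (hW : RegionWalk k T ω n) (h' : ℕ) {t : ℕ} (ht : t < n) :
    ∀ v ∈ (block (h' + 1) M ω t).getLast?, (zdGraph (d + 2)).Adj v (ω (t + 1)) := by
  intro v hv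
  unfold block at hv
  split_ifs at hv with htM
  · rw [List.getLast?_cons, List.getLast?_append, List.getLast?_reverse, head?_map_range_succ] at hv
    simp only [Option.some_or, Option.getD_some, Option.mem_def, Option.some.injEq] at hv
    subst hv
    simpa using (adj_add_hvec_one (ω (t + 1))).symm
  · simp only [List.getLast?_singleton, Option.mem_def, Option.some.injEq] at hv
    subst hv; exact hW.adj t ht

/-- Gluing the blocks. [folklore] -/
private theorem isChain_flatMap_blocks (hW : RegionWalk k T ω n) (hM : M ⊆ M0 T ω n) (h' : ℕ) :
    ∀ m ≤ n, ((List.range m).flatMap (block (h' + 1) M ω)).IsChain (zdGraph (d + 2)).Adj ∧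
      ∀ v ∈ ((List.range m).flatMap (block (h' + 1) M ω)).getLast?, (zdGraph (d + 2)).Adj v (ω m)
  | 0, _ => by simp
  | m + 1, hm => by
    obtain ⟨ih1, ih2⟩ := isChain_flatMap_blocks hW hM h' m (by omega)
    rw [List.range_succ, List.flatMap_append, List.flatMap_singleton]
    refine ⟨List.IsChain.append ih1 (isChain_block hW h' (by omega)) fun v hv y hy => ?_, ?_⟩
    · rw [head?_block, Option.mem_def, Option.some.injEq] at hy
      subst hy; exact ih2 v hv
    · intro v hv
      rw [List.getLast?_append] at hv
      obtain ⟨w, hw⟩ := List.getLast?_isSome.2 (block_ne_nil (h' + 1) M ω m) |> Option.isSome_iff_exists.1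
      rw [hw, Option.some_or, Option.mem_def, Option.some.injEq] at hv
      subst hv
      exact getLast_block_adj hW h' (by omega) w (by rw [hw]; rfl)

/-- **The image list is a nearest-neighbour chain.** [folklore] -/
private theorem isChain_imageList (hW : RegionWalk k T ω n) (hM : M ⊆ M0 T ω n) (h' : ℕ) :
    (imageList (h' + 1) M ω n).IsChain (zdGraph (d + 2)).Adj := by
  obtain ⟨h1, h2⟩ := isChain_flatMap_blocks hW hM h' n le_rfl
  exact List.IsChain.append h1 (List.isChain_singleton _) fun v hv y hy => by
    rw [List.head?_cons, Option.mem_def, Option.some.injEq] at hy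
    subst hy; exact h2 v hv

/-- The image list starts at `ω 0`. [folklore] -/
private theorem head?_imageList (h : ℕ) (M : Finset ℕ) (ω : ℕ → Site (d + 2)) (n : ℕ) :
    (imageList h M ω n).head? = some (ω 0) := by
  unfold imageList
  cases n with
  | zero => simp
  | succ n =>
    rw [List.range_succ_eq_map, List.flatMap_cons, List.append_assoc, List.head?_append,
      head?_block, Option.some_or]

/-- All points of the image lie in `R[k, T+1]`. [folklore] -/
private theorem box_mem_imageList (hW : RegionWalk k T ω n) (hM : M ⊆ M0 T ω n) {v : Site (d + 2)}
    (hv : v ∈ imageList (liftH T ω n) M ω n) :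
    ∀ i : Fin (d + 2), k ≤ i.val → 0 ≤ v i ∧ v i ≤ (T : ℤ) + 1 := by
  rw [imageList, List.mem_append, List.mem_flatMap, List.mem_singleton] at hv
  intro i hi
  rcases hv with ⟨t, ht, hvt⟩ | rfl
  · have htn := List.mem_range.1 ht
    rcases mem_block hvt with rfl | ⟨htM, hc⟩
    · have := hW.box t htn.le i hi; omega
    · obtain ⟨-, hte, hz, -⟩ := mem_M0 (hM htM)
      have hzh := zOf_add_liftH T ω n
      by_cases hiH : i = hI d
      · subst hiH
        rcases hc with ⟨-, h1, h2⟩ | ⟨-, h1, h2⟩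
        · have := (hW.height htn.le).1; omega
        · have := (hW.height (show t + 1 ≤ n by omega)).1
          have := hte.2.2; omega
      · rcases hc with ⟨hb, -, -⟩ | ⟨hb, -, -⟩
        · have e := (base_eq_iff.1 hb) i hiH
          have := hW.box t htn.le i hi; rw [e]; omega
        · have e := (base_eq_iff.1 hb) i hiH
          have := hW.box (t + 1) (by omega) i hi; rw [e]; omega
  · have := hW.box n le_rfl i hi; omega

end Image

/-! ### From vertex lists to the vertex functions of `saws` -/

/-- The vertex function of a vertex list, frozen at the last vertex. [folklore] -/
private def ofList (l : List (Site (d + 2))) (s : ℕ) : Site (d + 2) := (l[s]?).getD (l.getLast?.getD 0)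

/-- `ofList l s = l[s]` inside the list. [folklore] -/
private theorem ofList_eq_getElem {l : List (Site (d + 2))} {s : ℕ} (hs : s < l.length) : ofList l s = l[s] := by
  simp [ofList, List.getElem?_eq_getElem hs]

/-- `ofList l s` is the last vertex from the last index on. [folklore] -/
private theorem ofList_eq_getLast {l : List (Site (d + 2))} (hl : l ≠ []) {s : ℕ} (hs : l.length - 1 ≤ s) :
    ofList l s = l.getLast hl := by
  rcases lt_or_ge s l.length with h | h
  · rw [ofList_eq_getElem h, List.getLast_eq_getElem]
    congr 1; omega
  · simp [ofList, List.getElem?_eq_none h, List.getLast?_eq_getLast_of_ne_nil hl]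

/-- A duplicate-free nearest-neighbour vertex list, read as a vertex function translated to the
origin, is a walk of `saws`. [folklore] -/
private theorem ofList_sub_mem_saws {l : List (Site (d + 2))} (hl : l ≠ []) (hN : l.Nodup)
    (hC : l.IsChain (zdGraph (d + 2)).Adj) (p : Site (d + 2)) (hp : l.head? = some p) :
    (fun s => ofList l s - p) ∈ saws (d + 2) (l.length - 1) := by
  have hlen : 0 < l.length := List.length_pos_of_ne_nil hl
  have hp' : l[0] = p := by
    rw [← List.head_eq_getElem hl]; exact Option.some.inj ((List.head?_eq_some_head hl).symm.trans hp)
  rw [mem_saws]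
  refine ⟨?_, ?_, ?_, ?_⟩
  · show ofList l 0 - p = 0
    rw [ofList_eq_getElem hlen, hp', sub_self]
  · intro i hi
    show ofList l i - p = ofList l (l.length - 1) - p
    rw [ofList_eq_getLast hl hi, ofList_eq_getLast hl le_rfl]
  · intro i hi
    show (zdGraph (d + 2)).Adj (ofList l i - p) (ofList l (i + 1) - p)
    rw [zdGraph_adj_sub_right, ofList_eq_getElem (by omega), ofList_eq_getElem (by omega)]
    exact List.isChain_iff_getElem.1 hC i (by omega)
  · intro i hi j hj hij
    simp only [Set.mem_setOf_eq] at hi hj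
    have h' : ofList l i = ofList l j := sub_left_inj.1 hij
    rw [ofList_eq_getElem (by omega), ofList_eq_getElem (by omega)] at h'
    exact (hN.getElem_inj_iff).1 h'

/-- Two lists of the same length with the same vertex function are equal. [folklore] -/
private theorem ofList_inj {l l' : List (Site (d + 2))} (hlen : l.length = l'.length)
    (h : ∀ s, ofList l s = ofList l' s) : l = l' :=
  List.ext_getElem hlen fun i h1 h2 => by
    rw [← ofList_eq_getElem h1, ← ofList_eq_getElem h2, h i]

/-- A vertex function belongs to at most one `saws d m`. [folklore] -/
private theorem eq_of_mem_saws_of_mem_saws {e m m' : ℕ} {υ : ℕ → Site e} (h : υ ∈ saws e m)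
    (h' : υ ∈ saws e m') : m = m' := by
  obtain ⟨-, he, -, hi⟩ := mem_saws.1 h
  obtain ⟨-, he', -, hi'⟩ := mem_saws.1 h'
  by_contra hne
  rcases lt_or_gt_of_ne hne with hlt | hlt
  · have := hi' (show m ≤ m' by omega) (show m + 1 ≤ m' by omega) (he (m + 1) (by omega)).symm
    omega
  · have := hi (show m' ≤ m by omega) (show m' + 1 ≤ m by omega) (he' (m' + 1) (by omega)).symm
    omega

/-! ### The image walk and its decoding -/

/-- `Ψ(ω, M)` as a vertex function from the origin. [folklore] -/
private def psi (h : ℕ) (M : Finset ℕ) (ω : ℕ → Site (d + 2)) (n : ℕ) : ℕ → Site (d + 2) :=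
  fun s => ofList (imageList h M ω n) s - ω 0

/-- The image list is non-empty. [folklore] -/
private theorem imageList_ne_nil (h : ℕ) (M : Finset ℕ) (ω : ℕ → Site (d + 2)) (n : ℕ) :
    imageList h M ω n ≠ [] := by
  simp [imageList]

section Decode

variable {M : Finset ℕ}

/-- **`Ψ(ω,M)` is a self-avoiding walk of `R[k,T+1]`** from the same start, of length `|imageList| - 1`.
[folklore] -/
private theorem psi_mem_tubeWalksFrom (hW : RegionWalk k T ω n) (hM : M ⊆ M0 T ω n) :
    psi (liftH T ω n) M ω n ∈
      tubeWalksFrom (d + 2) k (T + 1) ((imageList (liftH T ω n) M ω n).length - 1) (ω 0) := by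
  have hh : liftH T ω n = (T - zOf T ω n) + 1 := rfl
  rw [mem_tubeWalksFrom]
  refine ⟨?_, ?_⟩
  · have := ofList_sub_mem_saws (imageList_ne_nil (liftH T ω n) M ω n) (nodup_imageList hW hM _)
      (by rw [hh]; exact isChain_imageList hW hM _) (ω 0) (head?_imageList _ M ω n)
    exact this
  · intro s _ i hi
    show 0 ≤ (ω 0 + (ofList (imageList (liftH T ω n) M ω n) s - ω 0)) i ∧
      (ω 0 + (ofList (imageList (liftH T ω n) M ω n) s - ω 0)) i ≤ ((T + 1 : ℕ) : ℤ)
    rw [add_sub_cancel]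
    have hmem : ofList (imageList (liftH T ω n) M ω n) s ∈ imageList (liftH T ω n) M ω n := by
      rcases lt_or_ge s (imageList (liftH T ω n) M ω n).length with h | h
      · rw [ofList_eq_getElem h]; exact List.getElem_mem h
      · rw [ofList_eq_getLast (imageList_ne_nil _ M ω n) (by omega)]; exact List.getLast_mem _
    have := box_mem_imageList hW hM hmem i hi
    push_cast; exact this

/-- The lifted columns of a list: the bases of its points at height `T + 1`. [folklore] -/
private def liftedCols (T : ℕ) (l : List (Site (d + 2))) : Finset (Site (d + 2)) :=
  (l.toFinset.filter fun v => v (hI d) = (T : ℤ) + 1).image base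

/-- Membership in `liftedCols`. [folklore] -/
private theorem mem_liftedCols {l : List (Site (d + 2))} {b : Site (d + 2)} :
    b ∈ liftedCols T l ↔ ∃ v ∈ l, v (hI d) = (T : ℤ) + 1 ∧ base v = b := by
  simp [liftedCols, and_assoc]

/-- The columns of the edges of `M`. [folklore] -/
private def colsOf (M : Finset ℕ) (ω : ℕ → Site (d + 2)) : Finset (Site (d + 2)) :=
  M.biUnion fun t => {base (ω t), base (ω (t + 1))}

/-- Membership in `colsOf`. [folklore] -/
private theorem mem_colsOf {b : Site (d + 2)} : b ∈ colsOf M ω ↔ ∃ t ∈ M, b = base (ω t) ∨ b = base (ω (t + 1)) := by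
  simp [colsOf]

/-- **The lifted columns of the image are the columns of `M`.** [folklore] -/
private theorem liftedCols_imageList (hW : RegionWalk k T ω n) (hM : M ⊆ M0 T ω n) :
    liftedCols T (imageList (liftH T ω n) M ω n) = colsOf M ω := by
  have hzh := zOf_add_liftH T ω n
  ext b
  rw [mem_liftedCols, mem_colsOf]
  constructor
  · rintro ⟨v, hv, hvh, rfl⟩
    rw [imageList, List.mem_append, List.mem_flatMap, List.mem_singleton] at hv
    rcases hv with ⟨t, ht, hvt⟩ | rfl
    · have htn := List.mem_range.1 ht
      rcases mem_block hvt with rfl | ⟨htM, hc⟩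
      · have := (hW.height htn.le).2; omega
      · rcases hc with ⟨hb, -, -⟩ | ⟨hb, -, -⟩
        · exact ⟨t, htM, Or.inl hb⟩
        · exact ⟨t, htM, Or.inr hb⟩
    · have := (hW.height le_rfl).2; omega
  · rintro ⟨t, htM, hb⟩
    obtain ⟨htn, hte, hz, -⟩ := mem_M0 (hM htM)
    have hmem : ∀ v ∈ block (liftH T ω n) M ω t, v ∈ imageList (liftH T ω n) M ω n := fun v hv => by
      rw [imageList, List.mem_append, List.mem_flatMap]
      exact Or.inl ⟨t, List.mem_range.2 htn, hv⟩
    have hup : ω t + hvec d (((liftH T ω n - 1 : ℕ) : ℤ) + 1) ∈ block (liftH T ω n) M ω t := by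
      unfold block; rw [if_pos htM]
      refine List.mem_cons_of_mem _ (List.mem_append_left _ (List.mem_map.2 ⟨liftH T ω n - 1, ?_, rfl⟩))
      rw [List.mem_range]; unfold liftH; omega
    have hdown : ω (t + 1) + hvec d (((liftH T ω n - 1 : ℕ) : ℤ) + 1) ∈ block (liftH T ω n) M ω t := by
      unfold block; rw [if_pos htM]
      refine List.mem_cons_of_mem _ (List.mem_append_right _ (List.mem_reverse.2
        (List.mem_map.2 ⟨liftH T ω n - 1, ?_, rfl⟩)))
      rw [List.mem_range]; unfold liftH; omega
    have hl1 : ((liftH T ω n - 1 : ℕ) : ℤ) + 1 = liftH T ω n := by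
      have : 1 ≤ liftH T ω n := by unfold liftH; omega
      omega
    rcases hb with rfl | rfl
    · refine ⟨_, hmem _ hup, ?_, base_add_hvec _ _⟩
      simp; rw [hl1, hz]; omega
    · refine ⟨_, hmem _ hdown, ?_, base_add_hvec _ _⟩
      simp; rw [hl1, ← hte.2.2, hz]; omega

/-- The Boolean test "keep the point": not (in a lifted column and above the level `z`). [folklore] -/
private def keep (z : ℤ) (L : Finset (Site (d + 2))) (v : Site (d + 2)) : Bool :=
  decide ¬ (base v ∈ L ∧ z < v (hI d))

/-- Filtering a block with the test leaves its anchor. [folklore] -/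
private theorem filter_keep_block (hM : M ⊆ M0 T ω n) (h : ℕ) {t : ℕ} (ht : t < n) :
    (block h M ω t).filter (keep (zOf T ω n) (colsOf M ω)) = [ω t] := by
  have hanchor : ∀ s ≤ n, keep (zOf T ω n : ℤ) (colsOf M ω) (ω s) = true := by
    intro s hs
    unfold keep
    rw [decide_eq_true_iff]
    rintro ⟨hL, hlt⟩
    obtain ⟨t', ht'M, hb⟩ := mem_colsOf.1 hL
    have := height_le_of_base_eq hM hs ht'M (by rcases hb with h | h <;> [exact Or.inl h; exact Or.inr h])
    omega
  unfold block
  split_ifs with htM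
  · have hbad : ∀ v ∈ ((List.range h).map fun j : ℕ => ω t + hvec d ((j : ℤ) + 1)) ++
        ((List.range h).map fun j : ℕ => ω (t + 1) + hvec d ((j : ℤ) + 1)).reverse,
        ¬ keep (zOf T ω n : ℤ) (colsOf M ω) v = true := by
      intro v hv
      unfold keep
      rw [decide_eq_true_iff, not_not]
      obtain ⟨-, hte, hz, -⟩ := mem_M0 (hM htM)
      rw [List.mem_append, List.mem_reverse, List.mem_map, List.mem_map] at hv
      rcases hv with ⟨j, -, rfl⟩ | ⟨j, -, rfl⟩
      · refine ⟨mem_colsOf.2 ⟨t, htM, Or.inl (base_add_hvec _ _)⟩, ?_⟩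
        simp; rw [hz]; omega
      · refine ⟨mem_colsOf.2 ⟨t, htM, Or.inr (base_add_hvec _ _)⟩, ?_⟩
        simp; rw [← hte.2.2, hz]; omega
    rw [List.filter_cons_of_pos (hanchor t ht.le), List.filter_eq_nil_iff.2 hbad]
  · rw [List.filter_cons_of_pos (hanchor t ht.le), List.filter_nil]

/-- **Decoding the walk**: filtering the image with the test returns `ω 0, …, ω n`. [folklore] -/
private theorem filter_keep_imageList (hM : M ⊆ M0 T ω n) (h : ℕ) :
    (imageList h M ω n).filter (keep (zOf T ω n) (colsOf M ω)) = (List.range (n + 1)).map ω := by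
  have hanchor : keep (zOf T ω n : ℤ) (colsOf M ω) (ω n) = true := by
    unfold keep
    rw [decide_eq_true_iff]
    rintro ⟨hL, hlt⟩
    obtain ⟨t', ht'M, hb⟩ := mem_colsOf.1 hL
    have := height_le_of_base_eq hM le_rfl ht'M (by rcases hb with h | h <;> [exact Or.inl h; exact Or.inr h])
    omega
  rw [imageList, List.filter_append, List.filter_flatMap,
    List.flatMap_congr fun t ht => filter_keep_block hM h (List.mem_range.1 ht),
    ← List.map_eq_flatMap, List.filter_cons_of_pos hanchor, List.filter_nil, List.range_succ,
    List.map_append, List.map_singleton]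

/-- **Decoding `M`**: within the fixed family, `M` is determined by its columns. [folklore] -/
private theorem eq_of_colsOf_eq (hW : RegionWalk k T ω n) {M' : Finset ℕ} (hM : M ⊆ M0 T ω n)
    (hM' : M' ⊆ M0 T ω n) (h : colsOf M ω = colsOf M' ω) : M = M' := by
  -- `t ∈ M₀` lies in `M` iff its first column is a column of `M`
  have key : ∀ {A : Finset ℕ}, A ⊆ M0 T ω n → ∀ t ∈ M0 T ω n, (t ∈ A ↔ base (ω t) ∈ colsOf A ω) := by
    intro A hA t ht
    constructor
    · intro h; exact mem_colsOf.2 ⟨t, h, Or.inl rfl⟩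
    · intro h
      obtain ⟨s, hs, hb⟩ := mem_colsOf.1 h
      by_cases hts : t = s
      · rwa [hts]
      · exfalso
        have hfar := far_of_mem_M0 ht (hA hs) hts
        obtain ⟨d1, d2, -, -⟩ := topEdge_cols_disjoint hW (mem_M0 ht).1 (mem_M0 (hA hs)).1
          (mem_M0 ht).2.1 (mem_M0 (hA hs)).2.1 hfar
        rcases hb with hb | hb
        · exact d1 hb
        · exact d2 hb
  ext t
  constructor
  · intro ht
    have := (key hM t (hM ht)).1 ht
    rw [h] at this
    exact (key hM' t (hM ht)).2 this
  · intro ht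
    have := (key hM' t (hM' ht)).1 ht
    rw [← h] at this
    exact (key hM t (hM' ht)).2 this

/-- **Injectivity given the level**: two pairs with the same image and the same chosen level have the
same walk (on `[0, n]`). [folklore] -/
private theorem eq_on_of_imageList_eq {ω' : ℕ → Site (d + 2)} {M' : Finset ℕ} (hW : RegionWalk k T ω n)
    (hW' : RegionWalk k T ω' n) (hM : M ⊆ M0 T ω n) (hM' : M' ⊆ M0 T ω' n)
    (hz : zOf T ω n = zOf T ω' n)
    (h : imageList (liftH T ω n) M ω n = imageList (liftH T ω' n) M' ω' n) : ∀ t ≤ n, ω t = ω' t := by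
  intro t ht
  have hL : colsOf M ω = colsOf M' ω' := by
    rw [← liftedCols_imageList hW hM, ← liftedCols_imageList hW' hM', h]
  have hf := filter_keep_imageList hM (liftH T ω n)
  rw [h, hz, hL, filter_keep_imageList hM' (liftH T ω' n)] at hf
  exact (List.map_inj_left.1 hf.symm t (List.mem_range.2 (Nat.lt_succ_of_le ht)))

end Decode

/-! ### The finite counting inequality (multiplicity `T + 1`) -/

section Counting

variable {a : Site (d + 2)} {υ : ℕ → Site (d + 2)}

/-- A walk of `tubeWalksFrom (d+2) k T n a`, translated by `a`, is a region walk (`1 ≤ k ≤ d+1`). [folklore] -/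
private theorem regionWalk_of_mem (hk : k ≤ d + 1) (hυ : υ ∈ tubeWalksFrom (d + 2) k T n a) :
    RegionWalk k T (fun t => a + υ t) n ∧ a + υ 0 = a := by
  obtain ⟨hs, hT⟩ := mem_tubeWalksFrom.1 hυ
  obtain ⟨h0, -, hadj, hinj⟩ := mem_saws.1 hs
  refine ⟨⟨fun t ht => ?_, fun t ht t' ht' h => hinj ht ht' (add_left_cancel h),
    fun t ht i hi => (hT t ht) i hi, hk⟩, by simp [h0]⟩
  rw [add_comm a, add_comm a, zdGraph_adj_add_right]
  exact hadj t ht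

/-- The pairs `(υ, M)`: a walk of `R[k,T]` from `a` and a subfamily of its fixed family `M₀`. [folklore] -/
private def dom (T n : ℕ) (a : Site (d + 2)) (k : ℕ) : Finset (Σ _ : ℕ → Site (d + 2), Finset ℕ) :=
  (tubeWalksFrom (d + 2) k T n a).sigma fun υ => (M0 T (fun t => a + υ t) n).powerset

/-- The length of the image of a pair. [folklore] -/
private def len (T n : ℕ) (a : Site (d + 2)) (p : Σ _ : ℕ → Site (d + 2), Finset ℕ) : ℕ :=
  n + 2 * liftH T (fun t => a + p.1 t) n * p.2.card

/-- The image of a pair. [folklore] -/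
private def F (T n : ℕ) (a : Site (d + 2)) (p : Σ _ : ℕ → Site (d + 2), Finset ℕ) : ℕ → Site (d + 2) :=
  psi (liftH T (fun t => a + p.1 t) n) p.2 (fun t => a + p.1 t) n

/-- Membership in `dom`. [folklore] -/
private theorem mem_dom {p : Σ _ : ℕ → Site (d + 2), Finset ℕ} :
    p ∈ dom T n a k ↔ p.1 ∈ tubeWalksFrom (d + 2) k T n a ∧ p.2 ⊆ M0 T (fun t => a + p.1 t) n := by
  rw [dom, Finset.mem_sigma, Finset.mem_powerset]

/-- The image length of a pair is at most `(2T+3) n`. [folklore] -/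
private theorem len_le (hk : k ≤ d + 1) {p : Σ _ : ℕ → Site (d + 2), Finset ℕ}
    (hp : p ∈ dom T n a k) : len T n a p ≤ (2 * T + 3) * n := by
  obtain ⟨hυ, hM⟩ := mem_dom.1 hp
  obtain ⟨hW, -⟩ := regionWalk_of_mem hk hυ
  have h1 : p.2.card ≤ n := by
    refine (Finset.card_le_card hM).trans ?_
    rw [card_M0 hW]; exact Nat.div_le_self _ _
  have h2 : liftH T (fun t => a + p.1 t) n ≤ T + 1 := by unfold liftH; omega
  unfold len
  nlinarith

/-- The image of a pair is a `(len)`-step walk of `R[k,T+1]` from `a`. [folklore] -/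
private theorem F_mem (hk : k ≤ d + 1) {p : Σ _ : ℕ → Site (d + 2), Finset ℕ}
    (hp : p ∈ dom T n a k) : F T n a p ∈ tubeWalksFrom (d + 2) k (T + 1) (len T n a p) a := by
  obtain ⟨hυ, hM⟩ := mem_dom.1 hp
  obtain ⟨hW, h0⟩ := regionWalk_of_mem hk hυ
  have h := psi_mem_tubeWalksFrom hW hM
  rw [length_imageList _ (fun t ht => (mem_M0 (hM ht)).1)] at h
  have e : n + 1 + 2 * liftH T (fun t => a + p.1 t) n * p.2.card - 1 = len T n a p := by unfold len; omega
  rw [e] at h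
  simpa only [F, h0] using h

/-- **Multiplicity**: on the pairs of a given image length, pairs with the same image and the same chosen
level coincide. [folklore] -/
private theorem eq_of_F_eq (hk : k ≤ d + 1) {m : ℕ}
    {p p' : Σ _ : ℕ → Site (d + 2), Finset ℕ} (hp : p ∈ (dom T n a k).filter fun p => len T n a p = m)
    (hp' : p' ∈ (dom T n a k).filter fun p => len T n a p = m) (hF : F T n a p = F T n a p')
    (hz : zOf T (fun t => a + p.1 t) n = zOf T (fun t => a + p'.1 t) n) : p = p' := by
  obtain ⟨hpd, hl⟩ := Finset.mem_filter.1 hp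
  obtain ⟨hpd', hl'⟩ := Finset.mem_filter.1 hp'
  obtain ⟨hυ, hM⟩ := mem_dom.1 hpd
  obtain ⟨hυ', hM'⟩ := mem_dom.1 hpd'
  obtain ⟨hW, h0⟩ := regionWalk_of_mem hk hυ
  obtain ⟨hW', h0'⟩ := regionWalk_of_mem hk hυ'
  have hlen : (imageList (liftH T (fun t => a + p.1 t) n) p.2 (fun t => a + p.1 t) n).length =
      (imageList (liftH T (fun t => a + p'.1 t) n) p'.2 (fun t => a + p'.1 t) n).length := by
    rw [length_imageList _ (fun t ht => (mem_M0 (hM ht)).1), length_imageList _ (fun t ht => (mem_M0 (hM' ht)).1)]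
    unfold len at hl hl'; omega
  have hlist := ofList_inj hlen fun s => by
    have := congrFun hF s
    simp only [F, psi, h0, h0'] at this
    exact sub_left_inj.1 this
  have hω := eq_on_of_imageList_eq hW hW' hM hM' hz hlist
  have hυυ : p.1 = p'.1 := by
    obtain ⟨-, he, -, -⟩ := mem_saws.1 (mem_tubeWalksFrom.1 hυ).1
    obtain ⟨-, he', -, -⟩ := mem_saws.1 (mem_tubeWalksFrom.1 hυ').1
    funext t
    rcases le_or_gt t n with ht | ht
    · exact add_left_cancel (hω t ht)
    · rw [he t ht.le, he' t ht.le]; exact add_left_cancel (hω n le_rfl)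
  obtain ⟨υ, M⟩ := p
  obtain ⟨υ', M'⟩ := p'
  simp only at hυυ
  subst hυυ
  have hMM : M = M' := by
    refine eq_of_colsOf_eq hW hM hM' ?_
    rw [← liftedCols_imageList hW hM, ← liftedCols_imageList hW hM', hlist]
  subst hMM
  rfl

open Classical in
/-- **Upper bound** (injectivity up to the `T + 1` guesses of the level). [folklore] -/
private theorem sum_dom_le (hk : k ≤ d + 1) {x : ℝ} (hx : 0 ≤ x) :
    ∑ p ∈ dom T n a k, x ^ len T n a p ≤
      ((T : ℝ) + 1) * ∑ m ∈ Finset.range ((2 * T + 3) * n + 1),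
        ((tubeWalksFrom (d + 2) k (T + 1) m a).card : ℝ) * x ^ m := by
  rw [← Finset.sum_fiberwise_of_maps_to (g := len T n a) (t := Finset.range ((2 * T + 3) * n + 1))
    fun p hp => Finset.mem_range.2 (Nat.lt_succ_of_le (len_le hk hp)), Finset.mul_sum]
  refine Finset.sum_le_sum fun m _ => ?_
  rw [Finset.sum_congr rfl fun p hp => by rw [(Finset.mem_filter.1 hp).2], Finset.sum_const, nsmul_eq_mul,
    ← mul_assoc]
  refine mul_le_mul_of_nonneg_right ?_ (pow_nonneg hx m)
  set s := (dom T n a k).filter fun p => len T n a p = m with hs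
  have h1 : s.card ≤ (T + 1) * (s.image (F T n a)).card := by
    refine Finset.card_le_mul_card_image _ _ fun y hy => ?_
    -- the fibre over `y` injects into the `T + 1` possible levels
    have := Finset.card_le_card_of_injOn (s := s.filter fun p => F T n a p = y) (t := Finset.range (T + 1))
      (fun p => zOf T (fun t => a + p.1 t) n) (fun p hp => ?_) (fun p hp p' hp' h => ?_)
    · simpa using this
    · simp only [Finset.coe_range, Set.mem_Iio]
      exact Nat.lt_succ_of_le (zOf_le T _ n)
    · have hp1 := (Finset.mem_filter.1 hp)
      have hp1' := (Finset.mem_filter.1 hp')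
      exact eq_of_F_eq hk hp1.1 hp1'.1 (hp1.2.trans hp1'.2.symm) h
  have h2 : (s.image (F T n a)).card ≤ (tubeWalksFrom (d + 2) k (T + 1) m a).card := by
    refine Finset.card_le_card (Finset.image_subset_iff.2 fun p hp => ?_)
    have hp' := Finset.mem_filter.1 hp
    simpa [hp'.2] using F_mem hk hp'.1
  calc (s.card : ℝ) ≤ ((T + 1) * (s.image (F T n a)).card : ℕ) := by exact_mod_cast h1
    _ ≤ ((T + 1) * (tubeWalksFrom (d + 2) k (T + 1) m a).card : ℕ) := by
        exact_mod_cast Nat.mul_le_mul_left _ h2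
    _ = ((T : ℝ) + 1) * ((tubeWalksFrom (d + 2) k (T + 1) m a).card : ℝ) := by push_cast; ring

/-- **Lower bound**: `Σ_{M ⊆ M₀} x^{n + 2h#M} = xⁿ (1 + x^{2h})^{#M₀} ≥ xⁿ (1 + x^{2T+2})^{n/Q}`. [folklore] -/
private theorem le_sum_dom (hk : k ≤ d + 1) {x : ℝ} (hx : 0 ≤ x) (hx1 : x ≤ 1) :
    ((tubeWalksFrom (d + 2) k T n a).card : ℝ) * x ^ n * (1 + x ^ (2 * T + 2)) ^ (n / Q d T) ≤
      ∑ p ∈ dom T n a k, x ^ len T n a p := by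
  rw [dom, Finset.sum_sigma]
  have key : ∀ υ ∈ tubeWalksFrom (d + 2) k T n a,
      x ^ n * (1 + x ^ (2 * T + 2)) ^ (n / Q d T) ≤
        ∑ M ∈ (M0 T (fun t => a + υ t) n).powerset, x ^ len T n a ⟨υ, M⟩ := by
    intro υ hυ
    obtain ⟨hW, -⟩ := regionWalk_of_mem hk hυ
    set h := liftH T (fun t => a + υ t) n with hh
    show _ ≤ ∑ M ∈ (M0 T (fun t => a + υ t) n).powerset, x ^ (n + 2 * h * M.card)
    have e : ∀ M : Finset ℕ, x ^ (n + 2 * h * M.card) =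
        x ^ n * ((x ^ (2 * h)) ^ M.card * 1 ^ ((M0 T (fun t => a + υ t) n).card - M.card)) := by
      intro M; rw [one_pow, mul_one, ← pow_mul, pow_add]
    rw [Finset.sum_congr rfl fun M _ => e M, ← Finset.mul_sum, Finset.sum_pow_mul_eq_add_pow,
      card_M0 hW]
    refine mul_le_mul_of_nonneg_left (pow_le_pow_left₀ (by positivity) ?_ _) (pow_nonneg hx n)
    have h2 : 2 * h ≤ 2 * T + 2 := by rw [hh]; unfold liftH; omega
    have := pow_le_pow_of_le_one hx hx1 h2
    linarith
  calc ((tubeWalksFrom (d + 2) k T n a).card : ℝ) * x ^ n * (1 + x ^ (2 * T + 2)) ^ (n / Q d T)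
      = ∑ _υ ∈ tubeWalksFrom (d + 2) k T n a, x ^ n * (1 + x ^ (2 * T + 2)) ^ (n / Q d T) := by
        rw [Finset.sum_const, nsmul_eq_mul, mul_assoc]
    _ ≤ _ := Finset.sum_le_sum key

/-- **The finite core** (one start `a`): for `0 ≤ x ≤ 1` and every `n`,
`#W_n(R[k,T]; a) · xⁿ · (1 + x^{2T+2})^{⌊n/Q⌋} ≤ (T+1) Σ_{m ≤ (2T+3)n} #W_m(R[k,T+1]; a) · x^m`. [folklore] -/
private theorem finite_core (hk : k ≤ d + 1) {x : ℝ} (hx : 0 ≤ x) (hx1 : x ≤ 1) :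
    ((tubeWalksFrom (d + 2) k T n a).card : ℝ) * x ^ n * (1 + x ^ (2 * T + 2)) ^ (n / Q d T) ≤
      ((T : ℝ) + 1) * ∑ m ∈ Finset.range ((2 * T + 3) * n + 1),
        ((tubeWalksFrom (d + 2) k (T + 1) m a).card : ℝ) * x ^ m :=
  (le_sum_dom hk hx hx1).trans (sum_dom_le hk hx)

end Counting

/-! ### Extraction of the margins: analysis -/

section Extraction

/-- For `0 < x < 1/γ` and `C_m^{1/m} → γ`, the sequence `C_m x^m` is bounded. [folklore] -/
private theorem exists_bound_of_tendsto_rpow {C : ℕ → ℝ} {γ x : ℝ} (hC0 : ∀ m, 0 ≤ C m)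
    (hC : Tendsto (fun m : ℕ => C m ^ (1 / (m : ℝ))) atTop (𝓝 γ)) (hγ : 0 < γ) (hx : 0 < x)
    (hxγ : x < 1 / γ) : ∃ K : ℝ, 0 ≤ K ∧ ∀ m, C m * x ^ m ≤ K := by
  set u : ℝ := (γ + x⁻¹) / 2 with hu
  have hxinv : γ < x⁻¹ := by
    have := (lt_one_div hx hγ).1 hxγ; rwa [one_div] at this
  have hγu : γ < u := by rw [hu]; linarith
  have hux : u * x ≤ 1 := by
    have : u < x⁻¹ := by rw [hu]; linarith
    have h1 : u * x < x⁻¹ * x := mul_lt_mul_of_pos_right this hx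
    rw [inv_mul_cancel₀ hx.ne'] at h1
    exact h1.le
  have hu0 : 0 ≤ u := by rw [hu]; positivity
  have hev : ∀ᶠ m : ℕ in atTop, C m * x ^ m ≤ 1 := by
    filter_upwards [hC.eventually_lt_const hγu, eventually_ge_atTop 1] with m hm hm1
    have hm0 : (m : ℕ) ≠ 0 := by omega
    have h1 : C m = (C m ^ (1 / (m : ℝ))) ^ m := by
      rw [one_div, Real.rpow_inv_natCast_pow (hC0 m) hm0]
    have h2 : C m ≤ u ^ m := by
      rw [h1]; exact pow_le_pow_left₀ (Real.rpow_nonneg (hC0 m) _) hm.le m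
    calc C m * x ^ m ≤ u ^ m * x ^ m := mul_le_mul_of_nonneg_right h2 (pow_nonneg hx.le m)
      _ = (u * x) ^ m := (mul_pow u x m).symm
      _ ≤ 1 := pow_le_one₀ (mul_nonneg hu0 hx.le) hux
  obtain ⟨N, hN⟩ := eventually_atTop.1 hev
  refine ⟨1 + ∑ m ∈ Finset.range N, C m * x ^ m, ?_, fun m => ?_⟩
  · have : 0 ≤ ∑ m ∈ Finset.range N, C m * x ^ m :=
      Finset.sum_nonneg fun m _ => mul_nonneg (hC0 m) (pow_nonneg hx.le m)
    linarith
  · rcases lt_or_ge m N with h | h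
    · have : C m * x ^ m ≤ ∑ m ∈ Finset.range N, C m * x ^ m :=
        Finset.single_le_sum (f := fun m => C m * x ^ m)
          (fun m _ => mul_nonneg (hC0 m) (pow_nonneg hx.le m)) (Finset.mem_range.2 h)
      linarith
    · have : 0 ≤ ∑ m ∈ Finset.range N, C m * x ^ m :=
        Finset.sum_nonneg fun m _ => mul_nonneg (hC0 m) (pow_nonneg hx.le m)
      linarith [hN m h]

/-- Exponential versus linear growth: if `yⁿ ≤ D·n` for all `n ≥ 1` then `y ≤ 1`. [folklore] -/
private theorem le_one_of_pow_le_mul {y D : ℝ} (hD : 0 ≤ D) (h : ∀ n : ℕ, 1 ≤ n → y ^ n ≤ D * n) :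
    y ≤ 1 := by
  by_contra hy1
  rw [not_le] at hy1
  have ht := tendsto_pow_const_div_const_pow_of_one_lt 1 hy1
  have hev := ht.eventually_lt_const (show (0 : ℝ) < 1 / (D + 1) by positivity)
  obtain ⟨N, hN⟩ := eventually_atTop.1 hev
  have hN1 := hN (N + 1) (by omega)
  have hn := h (N + 1) (by omega)
  have hpow : 0 < y ^ (N + 1) := pow_pos (by linarith) _
  simp only [pow_one] at hN1
  -- `1 ≤ D (N+1) / y^{N+1} < D/(D+1) < 1`
  have h1 : 1 ≤ D * (((N + 1 : ℕ) : ℝ) / y ^ (N + 1)) := by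
    rw [mul_div_assoc', le_div_iff₀ hpow, one_mul]; exact hn
  have h2 : D * (((N + 1 : ℕ) : ℝ) / y ^ (N + 1)) ≤ D * (1 / (D + 1)) :=
    mul_le_mul_of_nonneg_left hN1.le hD
  have h3 : D * (1 / (D + 1)) < 1 := by
    rw [mul_one_div, div_lt_one (by linarith)]; linarith
  linarith

/-- `n/Q ≤ ⌊n/Q⌋ + 1` between real and natural division (`Q ≥ 1`). [folklore] -/
private theorem div_le_natDiv_add_one (n : ℕ) {Q : ℕ} (hQ : 0 < Q) : (n : ℝ) / (Q : ℝ) ≤ ((n / Q : ℕ) : ℝ) + 1 := by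
  have h := Nat.lt_div_mul_add (a := n) (b := Q) hQ
  have hQ' : (0 : ℝ) < Q := by exact_mod_cast hQ
  rw [div_le_iff₀ hQ']
  have : (n : ℝ) ≤ ((n / Q : ℕ) : ℝ) * (Q : ℝ) + (Q : ℝ) := by exact_mod_cast h.le
  linarith

/-- **Extraction lemma.** If `αⁿ xⁿ (1 + x^E)^{⌊n/Q⌋} ≤ B Σ_{m ≤ Kn} C_m x^m` for all `n` and all
`0 < x ≤ 1`, where `C_m^{1/m} → γ ≥ 1` and `Q ≥ 1`, then `log(1 + γ^{-E})/Q ≤ log γ − log α`. [folklore] -/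
private theorem extract {α γ B : ℝ} {E Q K : ℕ} {C : ℕ → ℝ} (hα : 0 < α) (hγ : 1 ≤ γ) (hB : 0 ≤ B) (hQ : 0 < Q)
    (hC0 : ∀ m, 0 ≤ C m) (hC : Tendsto (fun m : ℕ => C m ^ (1 / (m : ℝ))) atTop (𝓝 γ))
    (h : ∀ n : ℕ, ∀ x : ℝ, 0 < x → x ≤ 1 →
      α ^ n * x ^ n * (1 + x ^ E) ^ (n / Q) ≤ B * ∑ m ∈ Finset.range (K * n + 1), C m * x ^ m) :
    Real.log (1 + γ ^ (-(E : ℝ))) / (Q : ℝ) ≤ Real.log γ - Real.log α := by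
  have hγ0 : 0 < γ := by linarith
  have hQ' : (0 : ℝ) < Q := by exact_mod_cast hQ
  set r : ℝ := 1 / (Q : ℝ) with hr
  have hr0 : 0 ≤ r := by rw [hr]; positivity
  set g : ℝ → ℝ := fun x => α * x * (1 + x ^ E) ^ r with hg
  have hB' : ∀ x : ℝ, 0 ≤ x → x < 1 / γ → g x ≤ 1 := by
    intro x hx0 hxγ
    rcases hx0.eq_or_lt with rfl | hx
    · simp [hg]
    have hx1 : x ≤ 1 := by
      have : 1 / γ ≤ 1 := by rw [div_le_one hγ0]; exact hγ
      linarith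
    obtain ⟨Kx, hKx0, hKx⟩ := exists_bound_of_tendsto_rpow hC0 hC hγ0 hx hxγ
    have hb1 : 1 ≤ 1 + x ^ E := by linarith [pow_nonneg hx.le E]
    have hgx : g x = α * x * (1 + x ^ E) ^ r := rfl
    refine le_one_of_pow_le_mul
      (show 0 ≤ (1 + x ^ E) * B * Kx * ((K : ℝ) + 1) by positivity) fun n hn => ?_
    have e1 : g x ^ n = α ^ n * x ^ n * (1 + x ^ E) ^ (r * n) := by
      rw [hgx, mul_pow, mul_pow, Real.rpow_mul (by linarith), Real.rpow_natCast]
    have e2 : (1 + x ^ E) ^ (r * n) ≤ (1 + x ^ E) ^ (n / Q) * (1 + x ^ E) := by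
      rw [← Real.rpow_natCast (1 + x ^ E) (n / Q), ← Real.rpow_add_one (by linarith)]
      refine Real.rpow_le_rpow_of_exponent_le hb1 ?_
      rw [hr, one_div_mul_eq_div]
      exact div_le_natDiv_add_one n hQ
    have e3 : ∑ m ∈ Finset.range (K * n + 1), C m * x ^ m ≤ ((K * n + 1 : ℕ) : ℝ) * Kx := by
      calc ∑ m ∈ Finset.range (K * n + 1), C m * x ^ m ≤ ∑ _m ∈ Finset.range (K * n + 1), Kx :=
            Finset.sum_le_sum fun m _ => hKx m
        _ = _ := by rw [Finset.sum_const, Finset.card_range, nsmul_eq_mul]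
    have e4 : ((K * n + 1 : ℕ) : ℝ) ≤ ((K : ℝ) + 1) * n := by
      push_cast
      have : (1 : ℝ) ≤ n := by exact_mod_cast hn
      nlinarith
    have hmain := h n x hx hx1
    calc g x ^ n = α ^ n * x ^ n * (1 + x ^ E) ^ (r * n) := e1
      _ ≤ α ^ n * x ^ n * ((1 + x ^ E) ^ (n / Q) * (1 + x ^ E)) :=
          mul_le_mul_of_nonneg_left e2 (by positivity)
      _ = (α ^ n * x ^ n * (1 + x ^ E) ^ (n / Q)) * (1 + x ^ E) := by ring
      _ ≤ (B * ∑ m ∈ Finset.range (K * n + 1), C m * x ^ m) * (1 + x ^ E) :=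
          mul_le_mul_of_nonneg_right hmain (by linarith)
      _ ≤ (B * (((K * n + 1 : ℕ) : ℝ) * Kx)) * (1 + x ^ E) :=
          mul_le_mul_of_nonneg_right (mul_le_mul_of_nonneg_left e3 hB) (by linarith)
      _ ≤ (B * ((((K : ℝ) + 1) * n) * Kx)) * (1 + x ^ E) :=
          mul_le_mul_of_nonneg_right (mul_le_mul_of_nonneg_left
            (mul_le_mul_of_nonneg_right e4 hKx0) hB) (by linarith)
      _ = (1 + x ^ E) * B * Kx * ((K : ℝ) + 1) * n := by ring
  have hcont : Continuous g := by
    rw [hg]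
    exact (continuous_const.mul continuous_id).mul
      ((continuous_const.add (continuous_pow E)).rpow_const fun x => Or.inr hr0)
  set xs : ℕ → ℝ := fun k => (1 / γ) * (1 - 1 / ((k : ℝ) + 1)) with hxs
  have hxs_lim : Tendsto xs atTop (𝓝 (1 / γ)) := by
    have h1 : Tendsto (fun k : ℕ => (1 : ℝ) - 1 / ((k : ℝ) + 1)) atTop (𝓝 (1 - 0)) :=
      tendsto_const_nhds.sub tendsto_one_div_add_atTop_nhds_zero_nat
    have h2 := h1.const_mul (1 / γ)
    rw [sub_zero, mul_one] at h2
    exact h2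
  have hgx0 : g (1 / γ) ≤ 1 := by
    refine le_of_tendsto' ((hcont.tendsto _).comp hxs_lim) fun k => hB' (xs k) ?_ ?_
    · rw [hxs]
      have : (0 : ℝ) ≤ 1 - 1 / ((k : ℝ) + 1) := by
        rw [sub_nonneg, div_le_one (by positivity)]; linarith
      positivity
    · rw [hxs]
      have h1 : (0 : ℝ) < 1 / ((k : ℝ) + 1) := by positivity
      have h2 : 0 < 1 / γ := by positivity
      nlinarith
  have hb : 0 < 1 + γ ^ (-(E : ℝ)) := by positivity
  have hval : g (1 / γ) = α * γ⁻¹ * (1 + γ ^ (-(E : ℝ))) ^ r := by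
    rw [hg]; simp only
    rw [one_div, Real.rpow_neg hγ0.le, Real.rpow_natCast, inv_pow]
  rw [hval] at hgx0
  have hpos : 0 < α * γ⁻¹ * (1 + γ ^ (-(E : ℝ))) ^ r := by positivity
  have hlog := Real.log_nonpos hpos.le hgx0
  rw [Real.log_mul (by positivity) (by positivity), Real.log_mul hα.ne' (by positivity),
    Real.log_inv, Real.log_rpow hb, hr, one_div_mul_eq_div] at hlog
  linarith

end Extraction

/-! ### Assembly -/

section Assembly

/-- The finite core summed over the starts of `R[k,T]`. [folklore] -/
private theorem summed_core (hk1 : 1 ≤ k) (hk : k ≤ d + 1) (T n : ℕ) {x : ℝ} (hx : 0 ≤ x) (hx1 : x ≤ 1) :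
    tubeConnectiveConstant (d + 2) k T ^ n * x ^ n * (1 + x ^ (2 * T + 2)) ^ (n / Q d T) ≤
      ((T : ℝ) + 1) * ∑ a ∈ tubeStarts (d + 2) k T, ∑ m ∈ Finset.range ((2 * T + 3) * n + 1),
        ((tubeWalksFrom (d + 2) k (T + 1) m a).card : ℝ) * x ^ m := by
  have h1 : tubeConnectiveConstant (d + 2) k T ^ n * x ^ n * (1 + x ^ (2 * T + 2)) ^ (n / Q d T) ≤
      (tubeCount (d + 2) k T n : ℝ) * x ^ n * (1 + x ^ (2 * T + 2)) ^ (n / Q d T) :=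
    mul_le_mul_of_nonneg_right (mul_le_mul_of_nonneg_right
      (StripInsertion.pow_tubeConnectiveConstant_le_tubeCount hk1 T n) (pow_nonneg hx n))
      (pow_nonneg (by linarith [pow_nonneg hx (2 * T + 2)]) _)
  refine h1.trans ?_
  rw [tubeCount_eq_sum]
  push_cast
  rw [Finset.sum_mul, Finset.sum_mul, Finset.mul_sum]
  exact Finset.sum_le_sum fun a _ => finite_core hk hx hx1

/-- The denominator as a real number. [folklore] -/
private theorem Q_cast (d T : ℕ) : ((Q d T : ℕ) : ℝ) = 4 * ((T : ℝ) + 1) ^ 2 * (2 * T + 1) ^ (d + 1) := by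
  simp [Q]

/-- **Quantitative (8.2.13) for every region `R[k,T] ⊂ ℤ^{d+2}`, `1 ≤ k ≤ d+1`** (this file; the source proves
strict monotonicity without a margin): with `Q = 4(T+1)²(2T+1)^{d+1}`,
`log(1 + μ(R[k,T+1])^{-(2T+2)}) / Q ≤ log μ(R[k,T+1]) − log μ(R[k,T])`.  Printed statement: Theorem 8.2.1,
book p. 269–270. [cite: MadrasSlade1993, §8.2, Theorem 8.2.1, eq. (8.2.13) (quantitative form, this file)] -/
theorem log_tubeConnectiveConstant_succ_sub_log_ge (hk1 : 1 ≤ k) (hk : k ≤ d + 1) (T : ℕ) :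
    Real.log (1 + tubeConnectiveConstant (d + 2) k (T + 1) ^ (-(2 * (T : ℝ) + 2))) /
        (4 * ((T : ℝ) + 1) ^ 2 * (2 * T + 1) ^ (d + 1)) ≤
      Real.log (tubeConnectiveConstant (d + 2) k (T + 1)) - Real.log (tubeConnectiveConstant (d + 2) k T) := by
  have hQ : 0 < Q d T := by unfold Q; positivity
  have h := extract (E := 2 * T + 2) (Q := Q d T) (K := 2 * T + 3)
    (C := fun m => (tubeCount (d + 2) k (T + 1) m : ℝ))
    (B := ((T : ℝ) + 1) * ((tubeStarts (d + 2) k T).card : ℝ))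
    (tubeConnectiveConstant_pos (d := d + 2) hk1 T) (one_le_tubeConnectiveConstant (d := d + 2) hk1 _)
    (by positivity) hQ (fun m => Nat.cast_nonneg _) (tendsto_tubeCount_rpow (d := d + 2) hk1 _)
    fun n x hx hx1 => (summed_core hk1 hk T n hx.le hx1).trans ?_
  · rw [Q_cast] at h
    have e : ((2 * T + 2 : ℕ) : ℝ) = 2 * (T : ℝ) + 2 := by push_cast; ring
    rwa [e] at h
  · rw [mul_assoc]
    refine mul_le_mul_of_nonneg_left ?_ (by positivity)
    rw [← nsmul_eq_mul, ← Finset.sum_const]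
    refine Finset.sum_le_sum fun a ha => Finset.sum_le_sum fun m _ =>
      mul_le_mul_of_nonneg_right ?_ (pow_nonneg hx.le m)
    exact_mod_cast card_tubeWalksFrom_le_tubeCount (tubeStarts_mono (Nat.le_succ T) ha)

/-- **Quantitative (8.2.11) for every region `R[k,T] ⊂ ℤ^{d+2}`, `1 ≤ k ≤ d+1`** (this file; the source proves
`μ(R) < μ` without a margin): `log(1 + μ(ℤ^{d+2})^{-(2T+2)}) / Q ≤ log μ(ℤ^{d+2}) − log μ(R[k,T])`.
Printed statement: book p. 269. [cite: MadrasSlade1993, §8.2, eq. (8.2.11) (remark before Theorem 8.2.1; quantitative form, this file)] -/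
theorem log_connectiveConstant_sub_log_tubeConnectiveConstant_ge (hk1 : 1 ≤ k) (hk : k ≤ d + 1) (T : ℕ) :
    Real.log (1 + connectiveConstant (d + 2) ^ (-(2 * (T : ℝ) + 2))) /
        (4 * ((T : ℝ) + 1) ^ 2 * (2 * T + 1) ^ (d + 1)) ≤
      Real.log (connectiveConstant (d + 2)) - Real.log (tubeConnectiveConstant (d + 2) k T) := by
  have hQ : 0 < Q d T := by unfold Q; positivity
  have h := extract (E := 2 * T + 2) (Q := Q d T) (K := 2 * T + 3)
    (C := fun m => (count (d + 2) m : ℝ))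
    (B := ((T : ℝ) + 1) * ((tubeStarts (d + 2) k T).card : ℝ))
    (tubeConnectiveConstant_pos (d := d + 2) hk1 T) (one_le_connectiveConstant (d + 2))
    (by positivity) hQ (fun m => Nat.cast_nonneg _) (tendsto_count_rpow (d + 2))
    fun n x hx hx1 => (summed_core hk1 hk T n hx.le hx1).trans ?_
  · rw [Q_cast] at h
    have e : ((2 * T + 2 : ℕ) : ℝ) = 2 * (T : ℝ) + 2 := by push_cast; ring
    rwa [e] at h
  · rw [mul_assoc]
    refine mul_le_mul_of_nonneg_left ?_ (by positivity)
    rw [← nsmul_eq_mul, ← Finset.sum_const]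
    refine Finset.sum_le_sum fun a _ => Finset.sum_le_sum fun m _ =>
      mul_le_mul_of_nonneg_right ?_ (pow_nonneg hx.le m)
    rw [← card_saws]
    exact_mod_cast Finset.card_le_card fun υ hυ => (mem_tubeWalksFrom.1 hυ).1

/-- **Theorem 8.2.1 (8.2.13)**: "`μ(R[k,T]) < μ(R[k,T+1])` for every `T`", for every region `R[k,T] ⊂ ℤ^{d+2}`
with `1 ≤ k ≤ d+1` (tubes AND slabs; book p. 269, proof p. 270; the slab case is Hammersley–Whittington 1985).
Here from the quantitative form (top-edge lift, not the printed renewal proof).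
[cite: MadrasSlade1993, §8.2, Theorem 8.2.1, eq. (8.2.13)] -/
theorem tubeConnectiveConstant_lt_succ (hk1 : 1 ≤ k) (hk : k ≤ d + 1) (T : ℕ) :
    tubeConnectiveConstant (d + 2) k T < tubeConnectiveConstant (d + 2) k (T + 1) := by
  have h := log_tubeConnectiveConstant_succ_sub_log_ge (d := d) hk1 hk T
  have hμ := tubeConnectiveConstant_pos (d := d + 2) hk1 (T + 1)
  have hpos : 0 < Real.log (1 + tubeConnectiveConstant (d + 2) k (T + 1) ^ (-(2 * (T : ℝ) + 2))) /
      (4 * ((T : ℝ) + 1) ^ 2 * (2 * T + 1) ^ (d + 1)) :=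
    div_pos (Real.log_pos (by linarith [Real.rpow_pos_of_pos hμ (-(2 * (T : ℝ) + 2))])) (by positivity)
  have : Real.log (tubeConnectiveConstant (d + 2) k T) < Real.log (tubeConnectiveConstant (d + 2) k (T + 1)) := by
    linarith
  exact (Real.log_lt_log_iff (tubeConnectiveConstant_pos (d := d + 2) hk1 T) hμ).1 this

/-- **(8.2.11)**: "`μ(R) < μ`" for every region `R[k,T] ⊂ ℤ^{d+2}`, `1 ≤ k ≤ d+1` (book p. 269, the remark
before Theorem 8.2.1; printed proof = Pattern Theorem). [cite: MadrasSlade1993, §8.2, eq. (8.2.11) (remark before Theorem 8.2.1)] -/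
theorem tubeConnectiveConstant_lt_connectiveConstant (hk1 : 1 ≤ k) (hk : k ≤ d + 1) (T : ℕ) :
    tubeConnectiveConstant (d + 2) k T < connectiveConstant (d + 2) := by
  have h := log_connectiveConstant_sub_log_tubeConnectiveConstant_ge (d := d) hk1 hk T
  have hμ := connectiveConstant_pos (d + 2)
  have hpos : 0 < Real.log (1 + connectiveConstant (d + 2) ^ (-(2 * (T : ℝ) + 2))) /
      (4 * ((T : ℝ) + 1) ^ 2 * (2 * T + 1) ^ (d + 1)) :=
    div_pos (Real.log_pos (by linarith [Real.rpow_pos_of_pos hμ (-(2 * (T : ℝ) + 2))])) (by positivity)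
  have : Real.log (tubeConnectiveConstant (d + 2) k T) < Real.log (connectiveConstant (d + 2)) := by linarith
  exact (Real.log_lt_log_iff (tubeConnectiveConstant_pos (d := d + 2) hk1 T) hμ).1 this

/-- **Theorem 8.2.1 (8.2.13), monotone form**: `T ↦ μ(R[k,T])` is strictly increasing, every `1 ≤ k ≤ d+1`
(book p. 269). [cite: MadrasSlade1993, §8.2, Theorem 8.2.1, eq. (8.2.13)] -/
theorem strictMono_tubeConnectiveConstant (hk1 : 1 ≤ k) (hk : k ≤ d + 1) :
    StrictMono fun T => tubeConnectiveConstant (d + 2) k T :=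
  strictMono_nat_of_lt_succ (tubeConnectiveConstant_lt_succ hk1 hk)

/-- (8.2.13) for every `d ≥ 2` and `1 ≤ k ≤ d-1` (tubes and slabs). [cite: MadrasSlade1993, §8.2, Theorem 8.2.1, eq. (8.2.13)] -/
theorem tubeConnectiveConstant_lt_succ_of_le {D K : ℕ} (hK1 : 1 ≤ K) (hKD : K + 1 ≤ D) (T : ℕ) :
    tubeConnectiveConstant D K T < tubeConnectiveConstant D K (T + 1) := by
  obtain ⟨d, rfl⟩ : ∃ d, D = d + 2 := ⟨D - 2, by omega⟩
  exact tubeConnectiveConstant_lt_succ hK1 (by omega) T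

/-- (8.2.11) for every `d ≥ 2` and `1 ≤ k ≤ d-1` (tubes and slabs). [cite: MadrasSlade1993, §8.2, eq. (8.2.11) (remark before Theorem 8.2.1)] -/
theorem tubeConnectiveConstant_lt_connectiveConstant_of_le {D K : ℕ} (hK1 : 1 ≤ K) (hKD : K + 1 ≤ D) (T : ℕ) :
    tubeConnectiveConstant D K T < connectiveConstant D := by
  obtain ⟨d, rfl⟩ : ∃ d, D = d + 2 := ⟨D - 2, by omega⟩
  exact tubeConnectiveConstant_lt_connectiveConstant hK1 (by omega) T


/-- **Quantitative (8.2.13), every region** — the displayed form for any `d ≥ 2`, `1 ≤ k ≤ d-1` (no `d+2`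
encoding): `log(1 + μ(R[k,T+1])^{-(2T+2)}) / (4(T+1)²(2T+1)^{d-1}) ≤ log μ(R[k,T+1]) − log μ(R[k,T])`.
[cite: MadrasSlade1993, §8.2, Theorem 8.2.1, eq. (8.2.13) (quantitative form, this file)] -/
theorem log_tubeConnectiveConstant_succ_sub_log_ge_of_le {D K : ℕ} (hK1 : 1 ≤ K) (hKD : K + 1 ≤ D) (T : ℕ) :
    Real.log (1 + tubeConnectiveConstant D K (T + 1) ^ (-(2 * (T : ℝ) + 2))) /
        (4 * ((T : ℝ) + 1) ^ 2 * (2 * T + 1) ^ (D - 1)) ≤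
      Real.log (tubeConnectiveConstant D K (T + 1)) - Real.log (tubeConnectiveConstant D K T) := by
  obtain ⟨d, rfl⟩ : ∃ d, D = d + 2 := ⟨D - 2, by omega⟩
  have := log_tubeConnectiveConstant_succ_sub_log_ge (d := d) hK1 (by omega) T
  simpa using this

/-- **Quantitative (8.2.11), every region** — the displayed form for any `d ≥ 2`, `1 ≤ k ≤ d-1`:
`log(1 + μ(ℤ^d)^{-(2T+2)}) / (4(T+1)²(2T+1)^{d-1}) ≤ log μ(ℤ^d) − log μ(R[k,T])`.
[cite: MadrasSlade1993, §8.2, eq. (8.2.11) (remark before Theorem 8.2.1; quantitative form, this file)] -/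
theorem log_connectiveConstant_sub_log_tubeConnectiveConstant_ge_of_le {D K : ℕ} (hK1 : 1 ≤ K)
    (hKD : K + 1 ≤ D) (T : ℕ) :
    Real.log (1 + connectiveConstant D ^ (-(2 * (T : ℝ) + 2))) /
        (4 * ((T : ℝ) + 1) ^ 2 * (2 * T + 1) ^ (D - 1)) ≤
      Real.log (connectiveConstant D) - Real.log (tubeConnectiveConstant D K T) := by
  obtain ⟨d, rfl⟩ : ∃ d, D = d + 2 := ⟨D - 2, by omega⟩
  have := log_connectiveConstant_sub_log_tubeConnectiveConstant_ge (d := d) hK1 (by omega) T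
  simpa using this

end Assembly

end TopLift

end Literature.Probability.RandomPlanarGeometry.SAW.Zd
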